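import Summits.QuantumFields.YangMills.Theorems.BalabanUVNodesN06Level13D2LayerAtPinsPUW
import Summits.QuantumFields.YangMills.Theorems.BalabanUVNodesN06Rgdd13AtPinsPUW
import Summits.QuantumFields.YangMills.Theorems.BalabanUVNodesN06StepL2AtPinsPhysR
import Summits.QuantumFields.YangMills.Theorems.BalabanUVNodesN06FormSmallIdentitiesAtPinsUSP
import Literature.MathematicalPhysics.QuantumFieldTheory.Balaban1983to89.B9OpsRTransport
import Summits.QuantumFields.YangMills.Theorems.BalabanUVNodesN06D2SupPrechainV2AtPinsPUW
import Summits.QuantumFields.YangMills.Theorems.BalabanUVNodesN06XdYdLegAtPinsPhysPU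
import Summits.QuantumFields.YangMills.Theorems.BalabanUVNodesN06DvLettersLegAtPinsPU
import Summits.QuantumFields.YangMills.Theorems.BalabanUVNodesN06G0QstarTransferLegAtPinsPU
import Summits.QuantumFields.YangMills.Theorems.BalabanUVNodesN06DgDvdLegAtPinsT
import Literature.MathematicalPhysics.QuantumFieldTheory.Balaban1983to89.B9GradLetterTransportedSupSource
import Literature.MathematicalPhysics.QuantumFieldTheory.Balaban1983to89.B9LettersZSchemasMono
import Literature.MathematicalPhysics.QuantumFieldTheory.Balaban1983to89.B9StateAprioriL1

/-!
# BalabanUVNodes ∕ N06 ([B9], `Dag.B9_main`) — THE LEVEL-13 LETTERS, THE Δ⁽²⁾ LETTER DERIVED, THE U8 STATE LAYER, THE BLOCK-L² STEP WITH ITS IDENTITIES, AND THE SECOND U8 LAYER'S `hrgdd13` LETTER, AS ONE LEG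

Track A of `YM-PLAN.md` (cell `pub-ymgap`, HUMAN RULING D-0062), node **N06** = [Balaban1985BackgroundPropagators] Thms 3.1–3.15; seat `pub-ymgap-dag-n06-d` (gen 22).
A BYTE-BUDGET LEG of the stage-11 certificate (edition 113 «VO» sits at 198 910 of 200 000 B): the certificate's SEQUENTIAL post-chain after this seat's FILE L2
`…N06Level13D2LayerAtPinsPUW.level13_d2_layer_of_pinsP_geo9Y` ✓p765741 — (§3a) the block-L² step `…N06StepL2AtPinsPhysR.stepL2_of_letter_schemas_residualR` run at the
DERIVED Δ⁽²⁾ letter (3.137) (Lemma 2.1 of [II] at the printed T_π ∕ T₂ constants `constL2 · tJ + θ₂ · constL2Pi`), (§3b) its rate conversion δT → δK, (§3c) dag-n06-l's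
`…N06FormSmallIdentitiesAtPinsUSP.formSmall_identities_of_stepL2` (⟹ `r12`, `FormSmall ∧ Identities` of Thm 3.12), (§3d) this seat's `…N06Rgdd13AtPinsPUW.hrgdd13_of_pinsP_geo9Y`
✓p763448 (the SECOND U8 layer above δ13 with LEG margin `τR` + dag-n06-c's `rgdd_of_pinsT`) fed the derived letter and the identities — is MOVED OUT of the certificate into ONE theorem that calls
FILE L2 BY NAME first.  Inputs = FILE L2's plus the post-chain's own: `τR hτR hR8a … hR8k` (second layer's margin ∕ budget in the U8 letters' rates), the (3.46) letter `h46` with `B₄ δ₄`, the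
smallness numerics `rS hrS0 hrSP hrSB hrS4 hrS2 hKT hδTr` (and `q : PinPrims`), the Δ⁽²⁾ symmetry schema `hΔ2` (a THEOREM at def-Y's residual, `resYOfC2P_Δ2_isSymmTr_SU`, supplied by the
certificate), the identities-of-form schema `hIdOfForm` ((3.124) ⟹ (3.152)), the pins `hRco12 hBi2₁₂`, `ht2` (T_π's constant IS the printed one) and `hσFK : σF ≤ δK`.  Output = FILE L2's
conjunction VERBATIM plus `r12 MF aF MR aR Br` with (10) the L² step at rate δK on `(MF, aD)` and `FormSmall ∧ Identities` on `(MF, aF)`, (11) the `hrgdd13` letter on `(MR, aR)`.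
HONEST LABEL: helper (plumbing of landed legs by name), count-neutral; every analytic member a displayed HYPOTHESIS of printed species or a landed theorem; N06 NOT discharged; nothing
continuum ∕ OS ∕ mass gap ∕ Clay.  [cite: Balaban1985BackgroundPropagators, Thm 3.3 (3.42)–(3.47) pp.397–399, (3.124)–(3.138) pp.420–423, (3.151)–(3.153) p.426; Balaban1984PropagatorsII,
(2.51)–(2.56) pp.232–233, Lemma 2.1 (2.59)–(2.61) pp.233–234]
-/

noncomputable section

namespace Summit.QuantumFields.YangMills.BalabanUVNodes.N06Level13D2Rgdd13LayerAtPinsPUW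

open Literature.MathematicalPhysics.QuantumFieldTheory.Balaban1983to89 open Literature.MathematicalPhysics.QuantumFieldTheory.Balaban1983to89.Node00 open Literature.MathematicalPhysics.QuantumFieldTheory.Balaban1983to89.Node00.OpsYSectDCoords (DvcoKH DvscoKH QscoKH RcoK T2coK TpicoK cR39_trBasis_pos) open Literature.MathematicalPhysics.QuantumFieldTheory.Balaban1983to89.B9Thm39ReadingCoords (basisBound39 cR39 cR39_nonneg coordBound39) open Literature.MathematicalPhysics.QuantumFieldTheory.Balaban1983to89.B9Thm34Ext (toB6) open Literature.MathematicalPhysics.QuantumFieldTheory.Balaban1983to89.B11SectG (BlockNorm HasMaj RowSum) open Literature.MathematicalPhysics.QuantumFieldTheory.Balaban1983to89.B9Thm312Whole (GeoOK Ops cNorm) open Literature.MathematicalPhysics.QuantumFieldTheory.Balaban1983to89.B9Thm312WholeClasses (cNormR rwt rwt_nonneg) open Literature.MathematicalPhysics.QuantumFieldTheory.Balaban1983to89.B9CoReadingCoords (DcoK DscoK GcoK XBK blkBK cdBₗ cdsBₗ coordOpK) open Literature.MathematicalPhysics.QuantumFieldTheory.Balaban1983to89.B9CoReadingCoordsS (GcoS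 XSK blkSK sIK) open Literature.MathematicalPhysics.QuantumFieldTheory.Balaban1983to89.B9CoReadingCoordsH (XHK blkHK) open Literature.MathematicalPhysics.QuantumFieldTheory.Balaban1983to89.B9CoReadingCoordsTranspose (TrIdx trBasis) open Literature.MathematicalPhysics.QuantumFieldTheory.Balaban1983to89.B9PinMembersKLevelV1 (MemberY bg9Y geo9Y geo9Y_M) open Literature.MathematicalPhysics.QuantumFieldTheory.Balaban1983to89.B9BackgroundsKLevelV1R (MemOfFam RegFamY bg9YR mem_of_reg335R) open Literature.MathematicalPhysics.QuantumFieldTheory.Balaban1983to89.B9GeoLemma21KLevelV1 (geo9Y_dist_comm geo9Y_dist_triangle geo9Y_len_pos rowSum261_geo9Y)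
open Literature.MathematicalPhysics.QuantumFieldTheory.Balaban1983to89.B9GeoNormsKLevelV1 (geo9K geo9K_dist_nonneg) open Literature.MathematicalPhysics.QuantumFieldTheory.Balaban1983to89.B7Prop2SpecialUnitary (specialUnitaryUnits specialUnitaryUnits_le_U1 specialUnitaryUnits_le_unitaryUnits) open Literature.MathematicalPhysics.QuantumFieldTheory.Balaban1983to89.B9PerturbationMajorantAlgebra (CurrentMaj Proj349Maj Thm31GpMaj hasMaj_weaken) open Literature.MathematicalPhysics.QuantumFieldTheory.Balaban1983to89.B9PerturbationMajorantsAtLetters (BcoKH BdcoKH PcoK rcoK_eq) open Literature.MathematicalPhysics.QuantumFieldTheory.Balaban1983to89.B9MultiscaleSmoothPartitionYNear (rNear) open Literature.MathematicalPhysics.QuantumFieldTheory.Balaban1983to89.B9MultiscaleSmoothPartitionYLip (CLip CLip_nonneg) open Literature.MathematicalPhysics.QuantumFieldTheory.Balaban1983to89.B9SmoothHolderClassP (bHZKP bHZKPG bHZKP_κ bHZPG) open Literature.MathematicalPhysics.QuantumFieldTheory.Balaban1983to89.B9GradViaDivLettersTransported (taxiB taxiS) open Literature.MathematicalPhysics.QuantumFieldTheory.Balaban1983to89.B9PerturbationSplitAtLetters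 (Ta2LcoK TaLcoK Tb2LcoKH TbLcoKH) open Literature.MathematicalPhysics.QuantumFieldTheory.Balaban1983to89.B9PerturbationL2Delta2 (D2coK) open Literature.MathematicalPhysics.QuantumFieldTheory.Balaban1983to89.Node00.OpsYSectDCoords (S0coK CcoK) open Literature.MathematicalPhysics.QuantumFieldTheory.Balaban1983to89.B9Eq3132SectDLetters (GDY) open Literature.MathematicalPhysics.QuantumFieldTheory.Balaban1983to89.B9Delta2FormMajorant (C2FormMaj) open Literature.MathematicalPhysics.QuantumFieldTheory.Balaban1983to89.B9BackgroundsKLevelV1P (bg9YP) open Literature.MathematicalPhysics.QuantumFieldTheory.Balaban1983to89.B9PinGeometryKLevelV1 (c35Y) open Literature.MathematicalPhysics.QuantumFieldTheory.Balaban1983to89.B9SmoothHolderClassPProducers (CTel CTel_nonneg) open Literature.MathematicalPhysics.QuantumFieldTheory.Balaban1983to89.B9RowSum261DefiniteFaces (rowConst261 rowConst261_nonneg) open Literature.MathematicalPhysics.QuantumFieldTheory.Balaban1983to89.B9SectDSup (weightNorm) open Literature.MathematicalPhysics.QuantumFieldTheory.Balaban1983to89.B6RandomWalk (HasMajorant)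
open Literature.MathematicalPhysics.QuantumFieldTheory.Balaban1983to89.B6RandomWalkHom (HasMajorantHom) open Literature.MathematicalPhysics.QuantumFieldTheory.Balaban1983to89.B9Thm312WholeStepRegular (LettersS3131 StepS) open Literature.MathematicalPhysics.QuantumFieldTheory.Balaban1983to89.B9CoReadingCoordsHolder (PK blkPK probeK w₀K) open Literature.MathematicalPhysics.QuantumFieldTheory.Balaban1983to89.B9CoReadingCoordsHolderAdm (holderProbesKA wKA) open Literature.MathematicalPhysics.QuantumFieldTheory.Balaban1983to89.B9RWSums343Holder (HolderProbes) open Literature.MathematicalPhysics.QuantumFieldTheory.Balaban1983to89.B9Thm313WholeDir (Thm33G0DirR) open Literature.MathematicalPhysics.QuantumFieldTheory.Balaban1983to89.B9Thm313WholeDirInputBC (Letters313IML) open Literature.MathematicalPhysics.QuantumFieldTheory.Balaban1983to89.B9LettersHZAtOne (plateau_pos) open Literature.MathematicalPhysics.QuantumFieldTheory.Balaban1983to89.B9CoReadingCoordsInput (bHK) open Literature.MathematicalPhysics.QuantumFieldTheory.Balaban1983to89.B9CoReadingCoordsInputS (bHS) open Literature.MathematicalPhysics.QuantumFieldTheory.Balaban1983to89.B9CoRealizesRelAtLetters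 (RelB) open Literature.MathematicalPhysics.QuantumFieldTheory.Balaban1983to89.B9Thm33G0ProbeZeroAtCutPins (pX0_of_pins) open Literature.MathematicalPhysics.QuantumFieldTheory.Balaban1983to89.B6GlobalChartV1 (PV blkV1) open Literature.MathematicalPhysics.QuantumFieldTheory.Balaban1983to89.B6Ineq2142KLevelV1 (lvl β) open Literature.MathematicalPhysics.QuantumFieldTheory.Balaban1983to89.B6Geom246MultiLevelTorus (geomT) open Summit.QuantumFields.YangMills.BalabanUVNodes.N06HolderPinsGradedAtRecord (links_le_one) open Summit.QuantumFields.YangMills.BalabanUVNodes.N06TbHLegAtPinsPhysPU (htbH_of_pinsP43_geo9Y)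
open Summit.QuantumFields.YangMills.BalabanUVNodes.N06LettersSAtPinsPU (hLettersS_of_pinsP44_geo9Y) open Summit.QuantumFields.YangMills.BalabanUVNodes.N06StateClassFactsAtPinsPU (hStateFacts_of_pinsP_geo9Y) open Summit.QuantumFields.YangMills.BalabanUVNodes.N06StateProducerG0AtPinsPU (hG0S2_of_pinsP_geo9Y) open Summit.QuantumFields.YangMills.BalabanUVNodes.N06StateProducersAAtPinsPU (hProducersA_of_pinsP_geo9Y) open Summit.QuantumFields.YangMills.BalabanUVNodes.N06StateProducersBAtPinsPUW (hProducersBW_of_pinsP_geo9Y) open Summit.QuantumFields.YangMills.BalabanUVNodes.N06StatePairsAtPinsPU (hStatePairs_of_pinsP_geo9Y) open Summit.QuantumFields.YangMills.BalabanUVNodes.N06StateAssemblyAtPinsPUW (hStateAssemblyW_of_faces) open Literature.MathematicalPhysics.QuantumFieldTheory.Balaban1983to89.B9SectDL2Decay (BlockBd) open Literature.MathematicalPhysics.QuantumFieldTheory.Balaban1983to89.B9Thm312WholeDir (Thm33G0Dir Thm33G0L2M) open Literature.MathematicalPhysics.QuantumFieldTheory.Balaban1983to89.B9RWSums343to347Whole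 (Facts347) open Literature.MathematicalPhysics.QuantumFieldTheory.Balaban1983to89.B9RWSums347DefiniteFaces (exp261 facts347_exp261_geo9Y geo9Y_scalars) open Literature.MathematicalPhysics.QuantumFieldTheory.Balaban1983to89.B9GradViaDivLettersAtPins (DvcoKH_eq_sum JcoKH rJ) open Literature.MathematicalPhysics.QuantumFieldTheory.Balaban1983to89.B9Thm313WholeDvAtPinsR (dGDv_pinsB dGDvd_pinsB gD2_pinsB gDv_pinsB pXDv_pinsB) open Literature.MathematicalPhysics.QuantumFieldTheory.Balaban1983to89.Node00.OpsYNablaBridge (chartY) open Literature.MathematicalPhysics.QuantumFieldTheory.Balaban1983to89.B9BackgroundsKLevelV1P (bg9KP mem_of_reg335P)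
open Literature.MathematicalPhysics.QuantumFieldTheory.Balaban1983to89.B9SmoothHolderClassPI (bHZKPIfam bHZPIfam transfer_threshold_geo9K) open Literature.MathematicalPhysics.QuantumFieldTheory.Balaban1983to89.B9SmoothHolderClassTClosure (abs_cf_eq_nKT) open Literature.MathematicalPhysics.QuantumFieldTheory.Balaban1983to89.B9SectBGpLettersY (norm_le_one_and_inv_of_mem) open Literature.MathematicalPhysics.QuantumFieldTheory.Balaban1983to89.B9GradLetterTransportedInputClassesPI (hasMaj_dgDv_of_h44m hasMaj_pdgDv_of_h45m jLadder_hyp_of_reg335P) open Literature.MathematicalPhysics.QuantumFieldTheory.Balaban1983to89.B6KLevelCensusIndexV1 (Adm kGeo) open T4RelativeLadder (UnitaryLike) open Literature.MathematicalPhysics.QuantumFieldTheory.Balaban1983to89.B9RWSums346SecondDiff (DirOps310) open Literature.MathematicalPhysics.QuantumFieldTheory.Balaban1983to89.B9Thm310Whole (Ops310) open Literature.MathematicalPhysics.QuantumFieldTheory.Balaban1983to89.B9Thm313WholeDvHolderAtPinsGraded (CJG CJG_nonneg thetaL thetaL_nonneg) open Literature.MathematicalPhysics.QuantumFieldTheory.Balaban1983to89.B9TaxiTransportLadder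 (plaqV) open Literature.MathematicalPhysics.QuantumFieldTheory.Balaban1983to89.B9Thm313WholeDvHolderAtPinsPrint (hJ_print) open Literature.MathematicalPhysics.QuantumFieldTheory.Balaban1983to89.B9Thm313WholeDvHolderFromDdsFree (pYDH_of_h45Y_one) open Literature.MathematicalPhysics.QuantumFieldTheory.Balaban1983to89.B6Prop22KLevelTorusCensusEta (nKT) open Summit.QuantumFields.YangMills.BalabanUVNodes.N06XdLegAtPinsPhysRU (one_le_CLip) 
open Literature.MathematicalPhysics.QuantumFieldTheory.Balaban1983to89.B9DivViaGradLettersAtPins (DvscoKH_eq_sum JTcoKH) open Literature.MathematicalPhysics.QuantumFieldTheory.Balaban1983to89.B9PerturbationMajorantsAtLettersPhys (rcoK_GpPhysY) open Literature.MathematicalPhysics.QuantumFieldTheory.Balaban1983to89.B9LettersZQstarFieldsAtPinsR (gQs1_pinsB pXQs_pinsB) open scoped Matrix.Norms.L2Operator open Literature.MathematicalPhysics.QuantumFieldTheory.Balaban1983to89.B9Thm312Whole (Thm33G0) open Literature.MathematicalPhysics.QuantumFieldTheory.Balaban1983to89.B9LettersZSchemasMono (kernel_mono) open Literature.MathematicalPhysics.QuantumFieldTheory.Balaban1983to89.B9StateAprioriL1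 (exists_l1_control_bHK) open Literature.MathematicalPhysics.QuantumFieldTheory.Balaban1983to89.B9GradLetterTransportedSupSource (hasMaj_bHZPIfam_of_supBlocks) open Summit.QuantumFields.YangMills.BalabanUVNodes.N06StateLayerAtPinsPUW (hStateTuplesW_of_pinsP_geo9Y) open Summit.QuantumFields.YangMills.BalabanUVNodes.N06D2SupPrechainV2AtPinsPUW (d2sup_prechain_v2_of_pins) open B9BackgroundsKLevelV1R (regY335 regY336) open B9RWSumsReadsNbr (nbr) open B9Thm311ReadingCoords (PosDefTr) open Literature.MathematicalPhysics.QuantumFieldTheory.Balaban1983to89.B9SectDL2Decay (BlockBd) open Literature.MathematicalPhysics.QuantumFieldTheory.Balaban1983to89.B9PerturbationL2Delta2 (D2coK) open Literature.MathematicalPhysics.QuantumFieldTheory.Balaban1983to89.Node00.OpsYSectDCoords (S0coK CcoK) open Literature.MathematicalPhysics.QuantumFieldTheory.Balaban1983to89.B9Eq3132SectDLetters (GDY) open Literature.MathematicalPhysics.QuantumFieldTheory.Balaban1983to89.B9Delta2FormMajorant (C2FormMaj) open Literature.MathematicalPhysics.QuantumFieldTheory.Balaban1983to89.B9BackgroundsKLevelV1P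 (bg9YP) open Literature.MathematicalPhysics.QuantumFieldTheory.Balaban1983to89.B9PinGeometryKLevelV1 (c35Y) open Summit.QuantumFields.YangMills.BalabanUVNodes.N06XdYdLegAtPinsPhysPU (hXd_of_pinsP_geo9Y pYDH_of_pinsP_geo9Y) open Summit.QuantumFields.YangMills.BalabanUVNodes.N06DgLegAtPinsPhysPU (dgDH_dgDHd_of_pinsP_geo9Y) open Summit.QuantumFields.YangMills.BalabanUVNodes.N06DvLettersLegAtPinsPU (dv_letters_of_pins pXDv_of_pins_KX)
open Summit.QuantumFields.YangMills.BalabanUVNodes.N06G0QstarTransferLegAtPinsPU (g0qstar_transfer_letters_of_pins) open Summit.QuantumFields.YangMills.BalabanUVNodes.N06DgDvdLegAtPinsT (dgDvd_pdgDvd_of_pinsT_all)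

open Summit.QuantumFields.YangMills.BalabanUVNodes.N06Level13D2LayerAtPinsPUW (level13_d2_layer_of_pinsP_geo9Y) open Summit.QuantumFields.YangMills.BalabanUVNodes.N06Rgdd13AtPinsPUW (hrgdd13_of_pinsP_geo9Y)
open Summit.QuantumFields.YangMills.BalabanUVNodes.N06StepL2AtPinsPhysR (stepL2_of_letter_schemas_residualR) open Summit.QuantumFields.YangMills.BalabanUVNodes.N06FormSmallIdentitiesAtPinsUSP (formSmall_identities_of_stepL2)
open B9OpsRTransport (ops312RY) open B9PerturbationL2Delta2 (constL2Pi constL2Pi_nonneg) open B9PerturbationL2Letters (constL2 constL2_nonneg) open B9RWSumsDefinitePins (PinPrims) open B9Thm311ReadingCoords (IsSymmTr) open B9Thm312Whole (FormSmall) open B9Thm312WholeL2 (StepL2)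

variable {N : ℕ}

set_option maxHeartbeats 1600000 in set_option synthInstance.maxSize 2048 in set_option maxRecDepth 8192 in -- one call of FILE L2 + the block-L² step + the identities + the hrgdd13 leg (the `ops312RY` transport unfolds deep)
/-- ★★★ **THE LEVEL-13 LETTERS, THE Δ⁽²⁾ LETTER DERIVED, THE U8 STATE LAYER, THE BLOCK-L² STEP ∕ IDENTITIES, AND THE SECOND LAYER'S `hrgdd13` LETTER, BUNDLED**
(module docstring): FILE L2's conclusion verbatim, plus `r12 MF aF MR aR Br` with the block-L² step at the U8 rate `δK` (regime `(MF, aD)`), Thm 3.12's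
`FormSmall ∧ Identities` (regime `(MF, aF)`), and the `hrgdd13` letter at rate `δ13` (regime `(MR, aR)`, `aR ≤ aF ≤ aD ≤ a₀`).
[cite: Balaban1985BackgroundPropagators, (3.137) p.423, (3.151)–(3.153) p.426, Thm 3.3 (3.46) p.398; Balaban1984PropagatorsII, Lemma 2.1 (2.60)–(2.61) p.234] -/
theorem level13_d2_rgdd13_layer_of_pinsP_geo9Y [NeZero N] (θ : Stage3Params) (Mstar : ℕ) [∀ x : MemberY θ.d₆ θ.ℓ₆ θ.hd' θ.hL' θ.b₀ θ.b₁ Mstar, Fintype (geo9Y x).Site] [∀ x : MemberY θ.d₆ θ.ℓ₆ θ.hd' θ.hL' θ.b₀ θ.b₁ Mstar, DecidableRel (RelB x.toKIdx)] [∀ x : MemberY θ.d₆ θ.ℓ₆ θ.hd' θ.hL' θ.b₀ θ.b₁ Mstar, DecidableEq (geo9Y x).Site]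
    {R₁ R₂ : RegFamY θ.d₆ θ.ℓ₆ θ.hd' θ.hL' θ.b₀ θ.b₁ Mstar (Matrix (Fin N) (Fin N) ℂ)} (H : MemberY θ.d₆ θ.ℓ₆ θ.hd' θ.hL' θ.b₀ θ.b₁ Mstar → Prop)
    (bI : ∀ x : MemberY θ.d₆ θ.ℓ₆ θ.hd' θ.hL' θ.b₀ θ.b₁ Mstar, FBondY x.toKIdx → IBondY x.toKIdx)
    (hlev : ∀ (x : MemberY θ.d₆ θ.ℓ₆ θ.hd' θ.hL' θ.b₀ θ.b₁ Mstar) (f : FBondY x.toKIdx), lvl x.hN x.D x.hk (bI x f) = (blkV1 x.hN x.D f).1.1)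
    (hβ1 : ∀ (x : MemberY θ.d₆ θ.ℓ₆ θ.hd' θ.hL' θ.b₀ θ.b₁ Mstar) (f : FBondY x.toKIdx), (geomT x.D).dist (β x.hN x.D x.hk (bI x f)) (blkV1 x.hN x.D f) ≤ 1)
    (hbI0 : ∀ (x : MemberY θ.d₆ θ.ℓ₆ θ.hd' θ.hL' θ.b₀ θ.b₁ Mstar) (f : FBondY x.toKIdx), bI x f = bI x ⟨f.src, 0⟩) (hGR : MemOfFam (specialUnitaryUnits (Fin N)) R₁) (c : ℝ)
    -- print's class (3.35) at the letters (the certificate's `hRP1 … .2.1`, `c35Y_le_ten`)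
    {c10 : ℝ} (hc10 : c10 ≤ 10)
    (hP : ∀ (x : MemberY θ.d₆ θ.ℓ₆ θ.hd' θ.hL' θ.b₀ θ.b₁ Mstar) (α₀ : ℝ) (U : (bg9YR (Matrix (Fin N) (Fin N) ℂ) (specialUnitaryUnits (Fin N)) R₁ R₂ x).Cfg),
      (bg9YR (Matrix (Fin N) (Fin N) ℂ) (specialUnitaryUnits (Fin N)) R₁ R₂ x).Reg335 c α₀ U → (bg9KP (Matrix (Fin N) (Fin N) ℂ) (specialUnitaryUnits (Fin N)) x.toKIdx).Reg335 c10 α₀ U)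
    -- ONE input regime for every letter below; the two margins σ τ of the U8 layer; the weights and the five input classes of record
    {M₀ a₀ : ℝ} (hM₀ : 0 ≤ M₀) (ha₀ : 0 < a₀) {σ τ : ℝ} (hσ : 0 < σ) (hτ : 0 < τ)
    (w13 : ℝ → ℝ) (hw13₀ : ∀ s, 0 ≤ w13 s) (hw13₁ : ∀ s, w13 s ≤ 1) (wX : ℝ → ℝ) (hwX₀ : ∀ s, 0 ≤ wX s) (hwX₁ : ∀ s, wX s ≤ 1)
    {s44 : ℝ} (hs440 : 0 < s44) (hs441 : s44 < 1) (hw1344 : 0 < w13 s44) (hwX44 : 0 < wX s44) (sch : ℝ → ℝ) (hsch0 : ∀ β', 0 ≤ β' → β' < 1 → 0 < sch β') (hsch1 : ∀ β', 0 ≤ β' → β' < 1 → sch β' < 1)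
    (hwsch : ∀ β', 0 ≤ β' → β' < 1 → 0 < w13 (sch β'))
    (bH13 : ∀ x : MemberY θ.d₆ θ.ℓ₆ θ.hd' θ.hL' θ.b₀ θ.b₁ Mstar, (bg9YR (Matrix (Fin N) (Fin N) ℂ) (specialUnitaryUnits (Fin N)) R₁ R₂ x).Cfg → BlockNorm (toB6 (geo9Y x) 1 (H x)) (XSK (TrIdx N) x.toKIdx → ℝ))
    (hbH13 : ∀ (x : MemberY θ.d₆ θ.ℓ₆ θ.hd' θ.hL' θ.b₀ θ.b₁ Mstar) (U : (bg9YR (Matrix (Fin N) (Fin N) ℂ) (specialUnitaryUnits (Fin N)) R₁ R₂ x).Cfg), bH13 x U =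
      letI : Fintype (geo9K x.toKIdx).Site := (inferInstance : Fintype (geo9Y x).Site);
      bHZPG (κ := TrIdx N) x.toKIdx (trBasis N) (taxiS x.toKIdx (bg9YR (Matrix (Fin N) (Fin N) ℂ) (specialUnitaryUnits (Fin N)) R₁ R₂ x) (fun U => U) U) (R := (1 : ℝ)) (H := H x) w13 hw13₀ hw13₁)
    (hκ13 : ∀ (x : MemberY θ.d₆ θ.ℓ₆ θ.hd' θ.hL' θ.b₀ θ.b₁ Mstar) (U : (bg9YR (Matrix (Fin N) (Fin N) ℂ) (specialUnitaryUnits (Fin N)) R₁ R₂ x).Cfg), (bH13 x U).κ ≤ 1 + CLip θ.d₆ θ.ℓ₆)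
    (bXH : ∀ x : MemberY θ.d₆ θ.ℓ₆ θ.hd' θ.hL' θ.b₀ θ.b₁ Mstar, (bg9YR (Matrix (Fin N) (Fin N) ℂ) (specialUnitaryUnits (Fin N)) R₁ R₂ x).Cfg → BlockNorm (toB6 (geo9Y x) 1 (H x)) (XBK (TrIdx N) x.toKIdx → ℝ))
    (hbXH : ∀ (x : MemberY θ.d₆ θ.ℓ₆ θ.hd' θ.hL' θ.b₀ θ.b₁ Mstar) (U : (bg9YR (Matrix (Fin N) (Fin N) ℂ) (specialUnitaryUnits (Fin N)) R₁ R₂ x).Cfg), bXH x U =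
      letI : Fintype (geo9K x.toKIdx).Site := (inferInstance : Fintype (geo9Y x).Site);
      bHZKPG (κ := TrIdx N) x.toKIdx (trBasis N) (taxiB x.toKIdx (bg9YR (Matrix (Fin N) (Fin N) ℂ) (specialUnitaryUnits (Fin N)) R₁ R₂ x) (fun U => U) U) (R := (1 : ℝ)) (H := H x) wX hwX₀ hwX₁)
    (bHXA : ∀ x : MemberY θ.d₆ θ.ℓ₆ θ.hd' θ.hL' θ.b₀ θ.b₁ Mstar, ℝ → BlockNorm (toB6 (geo9Y x) 1 (H x)) (XBK (TrIdx N) x.toKIdx → ℝ))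
    (hbHXA : ∀ x : MemberY θ.d₆ θ.ℓ₆ θ.hd' θ.hL' θ.b₀ θ.b₁ Mstar, bHXA x = fun ε => letI : Fintype (geo9K x.toKIdx).Site := (inferInstance : Fintype (geo9Y x).Site); bHK x.toKIdx (bI x) ε)
    (bHXT : ∀ x : MemberY θ.d₆ θ.ℓ₆ θ.hd' θ.hL' θ.b₀ θ.b₁ Mstar, (bg9YR (Matrix (Fin N) (Fin N) ℂ) (specialUnitaryUnits (Fin N)) R₁ R₂ x).Cfg → ℝ →
      BlockNorm (toB6 (geo9Y x) 1 (H x)) (XSK (TrIdx N) x.toKIdx → ℝ))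
    (hbHXT : ∀ (x : MemberY θ.d₆ θ.ℓ₆ θ.hd' θ.hL' θ.b₀ θ.b₁ Mstar) (U : (bg9YR (Matrix (Fin N) (Fin N) ℂ) (specialUnitaryUnits (Fin N)) R₁ R₂ x).Cfg), bHXT x U = fun ε =>
      letI : Fintype (geo9K x.toKIdx).Site := (inferInstance : Fintype (geo9Y x).Site)
      bHZPIfam (κ := TrIdx N) x.toKIdx (trBasis N) (taxiS x.toKIdx (bg9YR (Matrix (Fin N) (Fin N) ℂ) (specialUnitaryUnits (Fin N)) R₁ R₂ x) (fun U => U) U) (R := (1 : ℝ)) (H := H x) ε)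
    (bHXTA : ∀ x : MemberY θ.d₆ θ.ℓ₆ θ.hd' θ.hL' θ.b₀ θ.b₁ Mstar, (bg9YR (Matrix (Fin N) (Fin N) ℂ) (specialUnitaryUnits (Fin N)) R₁ R₂ x).Cfg → ℝ →
      BlockNorm (toB6 (geo9Y x) 1 (H x)) (XBK (TrIdx N) x.toKIdx → ℝ))
    (hbHXTA : ∀ (x : MemberY θ.d₆ θ.ℓ₆ θ.hd' θ.hL' θ.b₀ θ.b₁ Mstar) (U : (bg9YR (Matrix (Fin N) (Fin N) ℂ) (specialUnitaryUnits (Fin N)) R₁ R₂ x).Cfg), bHXTA x U = fun ε =>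
      letI : Fintype (geo9K x.toKIdx).Site := (inferInstance : Fintype (geo9Y x).Site)
      bHZKPIfam (κ := TrIdx N) x.toKIdx (trBasis N) (taxiB x.toKIdx (bg9YR (Matrix (Fin N) (Fin N) ℂ) (specialUnitaryUnits (Fin N)) R₁ R₂ x) (fun U => U) U) (R := (1 : ℝ)) (H := H x) ε)
    -- the operator record of Theorems 3.12–3.13 and its pins; the Hölder probes; Theorem 3.10's record (rows 19) and its direction operators
    (𝔬12 : ∀ x : MemberY θ.d₆ θ.ℓ₆ θ.hd' θ.hL' θ.b₀ θ.b₁ Mstar, B9Thm312Whole.Ops (geo9Y x) (bg9YR (Matrix (Fin N) (Fin N) ℂ) (specialUnitaryUnits (Fin N)) R₁ R₂ x) (XBK (TrIdx N) x.toKIdx) (XBK (TrIdx N) x.toKIdx) (XHK (TrIdx N) x.toKIdx) (XSK (TrIdx N) x.toKIdx))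
    (hblk12 : ∀ x : MemberY θ.d₆ θ.ℓ₆ θ.hd' θ.hL' θ.b₀ θ.b₁ Mstar, (𝔬12 x).blk = blkBK x.toKIdx (bI x)) (hblkW12 : ∀ x : MemberY θ.d₆ θ.ℓ₆ θ.hd' θ.hL' θ.b₀ θ.b₁ Mstar, (𝔬12 x).blkW = blkSK x.toKIdx (sIK x.toKIdx (bI x)))
    (hblkY12 : ∀ x : MemberY θ.d₆ θ.ℓ₆ θ.hd' θ.hL' θ.b₀ θ.b₁ Mstar, (𝔬12 x).blkY = blkBK x.toKIdx (bI x)) (hblkZ12 : ∀ x : MemberY θ.d₆ θ.ℓ₆ θ.hd' θ.hL' θ.b₀ θ.b₁ Mstar, (𝔬12 x).blkZ = blkHK x.toKIdx)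
    (O : ∀ x : MemberY θ.d₆ θ.ℓ₆ θ.hd' θ.hL' θ.b₀ θ.b₁ Mstar, BondOpY (Matrix (Fin N) (Fin N) ℂ) x.toKIdx)
    (hG0co12 : ∀ (x : MemberY θ.d₆ θ.ℓ₆ θ.hd' θ.hL' θ.b₀ θ.b₁ Mstar) (U : (bg9YR (Matrix (Fin N) (Fin N) ℂ) (specialUnitaryUnits (Fin N)) R₁ R₂ x).Cfg), (𝔬12 x).G0 U = GcoK x.toKIdx (trBasis N) (bg9YR (Matrix (Fin N) (Fin N) ℂ) (specialUnitaryUnits (Fin N)) R₁ R₂ x) (fun U => U) (O x) U)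
    (hDco12 : ∀ (x : MemberY θ.d₆ θ.ℓ₆ θ.hd' θ.hL' θ.b₀ θ.b₁ Mstar) (U : (bg9YR (Matrix (Fin N) (Fin N) ℂ) (specialUnitaryUnits (Fin N)) R₁ R₂ x).Cfg), (𝔬12 x).D U = DcoK x.toKIdx (trBasis N) (bg9YR (Matrix (Fin N) (Fin N) ℂ) (specialUnitaryUnits (Fin N)) R₁ R₂ x) (fun U => U) U)
    (hDsco12 : ∀ (x : MemberY θ.d₆ θ.ℓ₆ θ.hd' θ.hL' θ.b₀ θ.b₁ Mstar) (U : (bg9YR (Matrix (Fin N) (Fin N) ℂ) (specialUnitaryUnits (Fin N)) R₁ R₂ x).Cfg), (𝔬12 x).Dstar U = DscoK x.toKIdx (trBasis N) (bg9YR (Matrix (Fin N) (Fin N) ℂ) (specialUnitaryUnits (Fin N)) R₁ R₂ x) (fun U => U) U)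
    (𝔠 : C2Y N θ Mstar) (Δ2 : ∀ x : MemberY θ.d₆ θ.ℓ₆ θ.hd' θ.hL' θ.b₀ θ.b₁ Mstar, BondOpY (Matrix (Fin N) (Fin N) ℂ) x.toKIdx)
    (hΔ2def : ∀ x : MemberY θ.d₆ θ.ℓ₆ θ.hd' θ.hL' θ.b₀ θ.b₁ Mstar, Δ2 x = (delta2OfY (trDualMatY N) x.toKIdx (parSymY x.toKIdx) (parBY x.toKIdx) (GpPhysY x.toKIdx (parSymY x.toKIdx)) (𝔠 x).form))
    (hTpico12 : ∀ (x : MemberY θ.d₆ θ.ℓ₆ θ.hd' θ.hL' θ.b₀ θ.b₁ Mstar) (U : (bg9YR (Matrix (Fin N) (Fin N) ℂ) (specialUnitaryUnits (Fin N)) R₁ R₂ x).Cfg), (𝔬12 x).Tpi U = TpicoK x.toKIdx (trBasis N) (bg9YR (Matrix (Fin N) (Fin N) ℂ) (specialUnitaryUnits (Fin N)) R₁ R₂ x) (fun U => U) (parSymY x.toKIdx) (GpPhysY x.toKIdx (parSymY x.toKIdx)) U)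
    (hT2co12 : ∀ (x : MemberY θ.d₆ θ.ℓ₆ θ.hd' θ.hL' θ.b₀ θ.b₁ Mstar) (U : (bg9YR (Matrix (Fin N) (Fin N) ℂ) (specialUnitaryUnits (Fin N)) R₁ R₂ x).Cfg) , (𝔬12 x).T2 U = T2coK x.toKIdx (trBasis N) (bg9YR (Matrix (Fin N) (Fin N) ℂ) (specialUnitaryUnits (Fin N)) R₁ R₂ x) (fun U => U) (parSymY x.toKIdx) (GpPhysY x.toKIdx (parSymY x.toKIdx)) (Δ2 x) U)
    (hDvco12 : ∀ (x : MemberY θ.d₆ θ.ℓ₆ θ.hd' θ.hL' θ.b₀ θ.b₁ Mstar) (U : (bg9YR (Matrix (Fin N) (Fin N) ℂ) (specialUnitaryUnits (Fin N)) R₁ R₂ x).Cfg), (𝔬12 x).Dv U = DvcoKH x.toKIdx (trBasis N) (bg9YR (Matrix (Fin N) (Fin N) ℂ) (specialUnitaryUnits (Fin N)) R₁ R₂ x) (fun U => U) U)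
    (hDvsco12 : ∀ (x : MemberY θ.d₆ θ.ℓ₆ θ.hd' θ.hL' θ.b₀ θ.b₁ Mstar) (U : (bg9YR (Matrix (Fin N) (Fin N) ℂ) (specialUnitaryUnits (Fin N)) R₁ R₂ x).Cfg), (𝔬12 x).Dvstar U = DvscoKH x.toKIdx (trBasis N) (bg9YR (Matrix (Fin N) (Fin N) ℂ) (specialUnitaryUnits (Fin N)) R₁ R₂ x) (fun U => U) U)
    (hQsco12 : ∀ (x : MemberY θ.d₆ θ.ℓ₆ θ.hd' θ.hL' θ.b₀ θ.b₁ Mstar) (U : (bg9YR (Matrix (Fin N) (Fin N) ℂ) (specialUnitaryUnits (Fin N)) R₁ R₂ x).Cfg), (𝔬12 x).Qstar U = QscoKH x.toKIdx (trBasis N) (bg9YR (Matrix (Fin N) (Fin N) ℂ) (specialUnitaryUnits (Fin N)) R₁ R₂ x) (fun U => U) (parBY x.toKIdx) U)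
    (𝔭A : ∀ x : MemberY θ.d₆ θ.ℓ₆ θ.hd' θ.hL' θ.b₀ θ.b₁ Mstar, HolderProbes (geo9Y x) (bg9YR (Matrix (Fin N) (Fin N) ℂ) (specialUnitaryUnits (Fin N)) R₁ R₂ x) (XBK (TrIdx N) x.toKIdx) (XBK (TrIdx N) x.toKIdx) (PK (FBondY x.toKIdx) (Fin (θ.d₆ + 1)) (TrIdx N)) (PK (FBondY x.toKIdx) (Fin (θ.d₆ + 1)) (TrIdx N)))
    {parB : ∀ x : MemberY θ.d₆ θ.ℓ₆ θ.hd' θ.hL' θ.b₀ θ.b₁ Mstar, BondParY (Matrix (Fin N) (Fin N) ℂ) x.toKIdx} (hparB : ∀ x : MemberY θ.d₆ θ.ℓ₆ θ.hd' θ.hL' θ.b₀ θ.b₁ Mstar, parB x = parBY x.toKIdx)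
    (h𝔭A : ∀ x : MemberY θ.d₆ θ.ℓ₆ θ.hd' θ.hL' θ.b₀ θ.b₁ Mstar, 𝔭A x = holderProbesKA x.toKIdx (trBasis N) (bg9YR (Matrix (Fin N) (Fin N) ℂ) (specialUnitaryUnits (Fin N)) R₁ R₂ x) (fun U => U) (parB x) (bI x))
    {ιA AA : MemberY θ.d₆ θ.ℓ₆ θ.hd' θ.hL' θ.b₀ θ.b₁ Mstar → Type}
    (𝔬A : ∀ x : MemberY θ.d₆ θ.ℓ₆ θ.hd' θ.hL' θ.b₀ θ.b₁ Mstar, Ops310 (geo9Y x) (bg9YR (Matrix (Fin N) (Fin N) ℂ) (specialUnitaryUnits (Fin N)) R₁ R₂ x) (XBK (TrIdx N) x.toKIdx) (XBK (TrIdx N) x.toKIdx) (ιA x) (AA x))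
    (𝔡A : ∀ x : MemberY θ.d₆ θ.ℓ₆ θ.hd' θ.hL' θ.b₀ θ.b₁ Mstar, DirOps310 (𝔬A x) (Fin (θ.d₆ + 1)))
    (h𝔡Ad : ∀ (x : MemberY θ.d₆ θ.ℓ₆ θ.hd' θ.hL' θ.b₀ θ.b₁ Mstar) (U : (bg9YR (Matrix (Fin N) (Fin N) ℂ) (specialUnitaryUnits (Fin N)) R₁ R₂ x).Cfg), (𝔡A x).Dd U = fun μ => coordOpK (trBasis N) (fun _ : Fin (θ.d₆ + 1) => cdBₗ x.toKIdx U μ))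
    (h𝔡As : ∀ (x : MemberY θ.d₆ θ.ℓ₆ θ.hd' θ.hL' θ.b₀ θ.b₁ Mstar) (U : (bg9YR (Matrix (Fin N) (Fin N) ℂ) (specialUnitaryUnits (Fin N)) R₁ R₂ x).Cfg), (𝔡A x).Dsd U = fun μ => coordOpK (trBasis N) (fun _ : Fin (θ.d₆ + 1) => cdsBₗ x.toKIdx U μ))
    -- NUMERICS (implicit, read off the facts): the T-side letters' constants ∕ rates, the G₀ layer's, print's (3.32)-budget `ϑF`, rows 19's `Bi44 BZ BiY` at `δ44 δ45 δ45Y`,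
    -- the LEG margin `τR`, the second state layer's rates `δK δP` and the intermediate level-13 rate `δ13`
    {B₀ δ₀ CP δ49 tJ δB B43 δ43 tA δT δ₂ B44 δ44G B12₀ B12₂ δ12₀ BHG δ13 δK δP ϑF Bi44 δ44 δ45 δ45Y B0T B₃ : ℝ} {Bh12 Bi12 BZ BiY BhT BiT : ℝ → ℝ} {Bi2₁₂ Bi2T : ℝ → ℝ → ℝ}
    (hB₀ : 0 ≤ B₀) (hCP : 0 ≤ CP) (htJ : 0 ≤ tJ) (hB43 : 0 ≤ B43) (htA : 0 ≤ tA) (hB44 : 0 ≤ B44) (hB12₀ : 0 ≤ B12₀) (hB12₂ : 0 ≤ B12₂) (hBh12 : ∀ β', 0 ≤ β' → β' < 1 → 0 ≤ Bh12 β')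
    (hBi12 : ∀ ε, 0 < ε → ε ≤ 1 → 0 ≤ Bi12 ε) (hBHG : 0 ≤ BHG) (hwBhG : ∀ s, 0 < s → s < 1 → wX s * Bh12 s ≤ BHG)
    (hϑF : 0 ≤ ϑF) (hBi44 : 0 ≤ Bi44) (hBZ : ∀ β', 0 ≤ β' → β' < 1 → 0 ≤ BZ β') (hBiY : ∀ β', 0 ≤ β' → β' < 1 → 0 ≤ BiY β')
    (hBiT : ∀ ε, 0 < ε → ε ≤ 1 → 0 ≤ BiT ε) (hBi2T : ∀ ε β', 0 < ε → ε ≤ 1 → 0 ≤ β' → β' < 1 → 0 ≤ Bi2T ε β')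
    -- the (3.46) constant B₃ of the ∇G₀∇-letters at level 13 (the certificate's displayed `B12₃` with `hB12₃d ∕ hB12₃p` when δ13 = δ12₃)
    (hB₃ : 0 ≤ B₃) (hB3d : ((θ.d₆ : ℝ) + 1) * ((1 + CLip θ.d₆ θ.ℓ₆) * Bi44 * (CJG θ.d₆ θ.ℓ₆ (trBasis N) s44 (thetaL θ.d₆ θ.ℓ₆ ϑF) (w13 s44) (δ13 + 1 + 1 / 2 * (δ44 - δ13)) * (((θ.ℓ₆ + 1 : ℕ) : ℝ))) * rowConst261 (@geo9Y θ.d₆ θ.ℓ₆ θ.hd' θ.hL' θ.b₀ θ.b₁ Mstar) 1) ≤ B₃)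
    (hB3p : ((θ.d₆ : ℝ) + 1) * (1 * (((θ.d₆ : ℝ) + 1) * ((1 + CLip θ.d₆ θ.ℓ₆) * Bi44 * (CJG θ.d₆ θ.ℓ₆ (trBasis N) s44 (thetaL θ.d₆ θ.ℓ₆ ϑF) (w13 s44) (δ13 + 1 + 1 / 2 * (δ44 - δ13)) * (((θ.ℓ₆ + 1 : ℕ) : ℝ))) * rowConst261 (@geo9Y θ.d₆ θ.ℓ₆ θ.hd' θ.hL' θ.b₀ θ.b₁ Mstar) 1)) * rowConst261 (@geo9Y θ.d₆ θ.ℓ₆ θ.hd' θ.hL' θ.b₀ θ.b₁ Mstar) 1) ≤ B₃)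
    -- RATE BUDGET: the U8 budget of `hStateTuplesW_of_pinsP_geo9Y` at (δK, δP) with the level-13 slots read at δ13, and the [4] (2.60) transfer gaps of the level-13
    -- suppliers (`δ13 < δ12₀ ∕ δ44 ∕ δ45 ∕ δ45Y`); at the certificate's layer of record (δK, δP, δ13) = (δK12, δP, δ12₃)
    (hδK0 : 0 ≤ δK)
    (hr0 : δK + 3 * σ + 4 * τ ≤ δ₀) (hr49 : δK + 3 * σ + 4 * τ ≤ δ49) (hr2 : δK + 3 * σ + 4 * τ ≤ δ₂) (hr44 : δK + 3 * σ + 5 * τ ≤ δ44G) (hrB : δK + 3 * σ + 4 * τ ≤ δB)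
    (hr43 : δK + 2 * σ + τ ≤ δ43) (hrT : δK + τ + σ ≤ δT) (hK3d : δK + τ + σ ≤ δ13) (hKP : δK + τ + σ ≤ δP) (hP0 : δP + 2 * τ ≤ δ12₀) (hP3 : δP + σ + 2 * τ ≤ δ13)
    (h130 : δ13 < δ12₀) (h1344 : δ13 < δ44) (h1345 : δ13 < δ45) (h1345Y : δ13 < δ45Y)
    -- LETTERS (all on the regime (M₀, a₀)): the T-side letters of the U8 layer VERBATIM (`h31 h49 h43 h44G hta hBJ`; the Δ⁽²⁾ letter `hD2` is DERIVED inside)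
    (h31 : ∀ x : MemberY θ.d₆ θ.ℓ₆ θ.hd' θ.hL' θ.b₀ θ.b₁ Mstar, M₀ ≤ (geo9Y x).M → ∀ α₀ : ℝ, 0 < α₀ → (geo9Y x).M * α₀ ≤ a₀ → ∀ U : (bg9YR (Matrix (Fin N) (Fin N) ℂ) (specialUnitaryUnits (Fin N)) R₁ R₂ x).Cfg, (bg9YR (Matrix (Fin N) (Fin N) ℂ) (specialUnitaryUnits (Fin N)) R₁ R₂ x).Reg335 c α₀ U →
      Thm31GpMaj (g := geo9Y x) (blkSK x.toKIdx (sIK x.toKIdx (bI x))) (blkBK x.toKIdx (bI x))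
        (GcoS x.toKIdx (trBasis N) (bg9YR (Matrix (Fin N) (Fin N) ℂ) (specialUnitaryUnits (Fin N)) R₁ R₂ x) (fun U => U) (GpY x.toKIdx (parSymY x.toKIdx)) U)
        (DvcoKH x.toKIdx (trBasis N) (bg9YR (Matrix (Fin N) (Fin N) ℂ) (specialUnitaryUnits (Fin N)) R₁ R₂ x) (fun U => U) U) (DvscoKH x.toKIdx (trBasis N) (bg9YR (Matrix (Fin N) (Fin N) ℂ) (specialUnitaryUnits (Fin N)) R₁ R₂ x) (fun U => U) U) 1 (H x) B₀ δ₀)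
    (h49 : ∀ x : MemberY θ.d₆ θ.ℓ₆ θ.hd' θ.hL' θ.b₀ θ.b₁ Mstar, M₀ ≤ (geo9Y x).M → ∀ α₀ : ℝ, 0 < α₀ → (geo9Y x).M * α₀ ≤ a₀ → ∀ U : (bg9YR (Matrix (Fin N) (Fin N) ℂ) (specialUnitaryUnits (Fin N)) R₁ R₂ x).Cfg, (bg9YR (Matrix (Fin N) (Fin N) ℂ) (specialUnitaryUnits (Fin N)) R₁ R₂ x).Reg335 c α₀ U →
      Proj349Maj (g := geo9Y x) (blkSK x.toKIdx (sIK x.toKIdx (bI x))) (blkBK x.toKIdx (bI x))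
        (PcoK x.toKIdx (trBasis N) (bg9YR (Matrix (Fin N) (Fin N) ℂ) (specialUnitaryUnits (Fin N)) R₁ R₂ x) (fun U => U) (parSymY x.toKIdx) (GpY x.toKIdx (parSymY x.toKIdx)) U)
        (DvcoKH x.toKIdx (trBasis N) (bg9YR (Matrix (Fin N) (Fin N) ℂ) (specialUnitaryUnits (Fin N)) R₁ R₂ x) (fun U => U) U) (DvscoKH x.toKIdx (trBasis N) (bg9YR (Matrix (Fin N) (Fin N) ℂ) (specialUnitaryUnits (Fin N)) R₁ R₂ x) (fun U => U) U) 1 (H x) CP δ49)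
    (h43 : ∀ x : MemberY θ.d₆ θ.ℓ₆ θ.hd' θ.hL' θ.b₀ θ.b₁ Mstar, letI : Fintype (geo9K x.toKIdx).Site := (inferInstance : Fintype (geo9Y x).Site); M₀ ≤ (geo9Y x).M → ∀ α₀ : ℝ, 0 < α₀ → (geo9Y x).M * α₀ ≤ a₀ → ∀ U : (bg9YR (Matrix (Fin N) (Fin N) ℂ) (specialUnitaryUnits (Fin N)) R₁ R₂ x).Cfg, (bg9YR (Matrix (Fin N) (Fin N) ℂ) (specialUnitaryUnits (Fin N)) R₁ R₂ x).Reg335 c α₀ U →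
      (bg9YR (Matrix (Fin N) (Fin N) ℂ) (specialUnitaryUnits (Fin N)) R₁ R₂ x).Reg336 c α₀ U →
        HasMaj (cNorm 1 (H x) (𝔬12 x).blk (fun y => (geo9Y_len_pos x y).le) 0) (bH13 x U)
          (GcoS x.toKIdx (trBasis N) (bg9YR (Matrix (Fin N) (Fin N) ℂ) (specialUnitaryUnits (Fin N)) R₁ R₂ x) (fun U => U) (GpY x.toKIdx (parSymY x.toKIdx)) U ∘ₗ DvscoKH x.toKIdx (trBasis N) (bg9YR (Matrix (Fin N) (Fin N) ℂ) (specialUnitaryUnits (Fin N)) R₁ R₂ x) (fun U => U) U)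
          (fun a a' => B43 * Real.exp (-(δ43 * (geo9Y x).dist a a'))))
    (h44G : ∀ x : MemberY θ.d₆ θ.ℓ₆ θ.hd' θ.hL' θ.b₀ θ.b₁ Mstar, letI : Fintype (geo9K x.toKIdx).Site := (inferInstance : Fintype (geo9Y x).Site); M₀ ≤ (geo9Y x).M → ∀ α₀ : ℝ, 0 < α₀ → (geo9Y x).M * α₀ ≤ a₀ → ∀ U : (bg9YR (Matrix (Fin N) (Fin N) ℂ) (specialUnitaryUnits (Fin N)) R₁ R₂ x).Cfg, (bg9YR (Matrix (Fin N) (Fin N) ℂ) (specialUnitaryUnits (Fin N)) R₁ R₂ x).Reg335 c α₀ U → (bg9YR (Matrix (Fin N) (Fin N) ℂ) (specialUnitaryUnits (Fin N)) R₁ R₂ x).Reg336 c α₀ U →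
      HasMaj (bHZKP (κ := TrIdx N) x.toKIdx (trBasis N) (taxiB x.toKIdx (bg9YR (Matrix (Fin N) (Fin N) ℂ) (specialUnitaryUnits (Fin N)) R₁ R₂ x) (fun U => U) U) (R := (1 : ℝ)) (H := H x) hs440.le hs441.le) (cNorm 1 (H x) (𝔬12 x).blk (fun y => (geo9Y_len_pos x y).le) 1)
        ((𝔬12 x).Dv U ∘ₗ GcoS x.toKIdx (trBasis N) (bg9YR (Matrix (Fin N) (Fin N) ℂ) (specialUnitaryUnits (Fin N)) R₁ R₂ x) (fun U => U) (GpY x.toKIdx (parSymY x.toKIdx)) U ∘ₗ (𝔬12 x).Dvstar U) (fun a b => B44 * Real.exp (-(δ44G * (geo9Y x).dist a b))))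
    (hta : ∀ x : MemberY θ.d₆ θ.ℓ₆ θ.hd' θ.hL' θ.b₀ θ.b₁ Mstar, M₀ ≤ (geo9Y x).M → ∀ α₀ : ℝ, 0 < α₀ → (geo9Y x).M * α₀ ≤ a₀ → ∀ U : (bg9YR (Matrix (Fin N) (Fin N) ℂ) (specialUnitaryUnits (Fin N)) R₁ R₂ x).Cfg, (bg9YR (Matrix (Fin N) (Fin N) ℂ) (specialUnitaryUnits (Fin N)) R₁ R₂ x).Reg335 c α₀ U →
      (bg9YR (Matrix (Fin N) (Fin N) ℂ) (specialUnitaryUnits (Fin N)) R₁ R₂ x).Reg336 c α₀ U → HasMaj (cNorm 1 (H x) (𝔬12 x).blk (fun y => (geo9Y_len_pos x y).le) 2) (cNorm 1 (H x) (𝔬12 x).blk (fun y => (geo9Y_len_pos x y).le) 0) (TaLcoK x.toKIdx (trBasis N) (bg9YR (Matrix (Fin N) (Fin N) ℂ) (specialUnitaryUnits (Fin N)) R₁ R₂ x) (fun U => U) (parSymY x.toKIdx) (GpPhysY x.toKIdx (parSymY x.toKIdx)) U) (fun a a' => tA * ((geo9Y x).M * α₀) * Real.exp (-(δT * (geo9Y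 x).dist a a'))))
    (hBJ : ∀ x : MemberY θ.d₆ θ.ℓ₆ θ.hd' θ.hL' θ.b₀ θ.b₁ Mstar, M₀ ≤ (geo9Y x).M → ∀ α₀ : ℝ, 0 < α₀ → (geo9Y x).M * α₀ ≤ a₀ → ∀ U : (bg9YR (Matrix (Fin N) (Fin N) ℂ) (specialUnitaryUnits (Fin N)) R₁ R₂ x).Cfg, (bg9YR (Matrix (Fin N) (Fin N) ℂ) (specialUnitaryUnits (Fin N)) R₁ R₂ x).Reg335 c α₀ U →
      (bg9YR (Matrix (Fin N) (Fin N) ℂ) (specialUnitaryUnits (Fin N)) R₁ R₂ x).Reg336 c α₀ U → CurrentMaj (𝔬12 x).blkW (𝔬12 x).blk (BcoKH x.toKIdx (trBasis N) (bg9YR (Matrix (Fin N) (Fin N) ℂ) (specialUnitaryUnits (Fin N)) R₁ R₂ x) (fun U => U) U)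
        (BdcoKH x.toKIdx (trBasis N) (bg9YR (Matrix (Fin N) (Fin N) ℂ) (specialUnitaryUnits (Fin N)) R₁ R₂ x) (fun U => U) U) 1 (H x) (tJ * ((geo9Y x).M * α₀)) δB)
    -- the G₀ layer (`g0_layer_of_thm310_coreDir₃USP`): Thm 3.3 for G₀ (blocks ∕ directions ∕ adjoint directions ∕ mixed L²), the (3.39)-hom letter ∇_UG₀, the identities; and Thm 3.3 for G₀ at
    -- the TRANSPORTED bond class (`thm33G0DirT_of_local3107`)
    (hG0 : ∀ x : MemberY θ.d₆ θ.ℓ₆ θ.hd' θ.hL' θ.b₀ θ.b₁ Mstar, M₀ ≤ (geo9Y x).M → ∀ α₀ : ℝ, 0 < α₀ → (geo9Y x).M * α₀ ≤ a₀ → ∀ U : (bg9YR (Matrix (Fin N) (Fin N) ℂ) (specialUnitaryUnits (Fin N)) R₁ R₂ x).Cfg, (bg9YR (Matrix (Fin N) (Fin N) ℂ) (specialUnitaryUnits (Fin N)) R₁ R₂ x).Reg335 c α₀ U →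
      (bg9YR (Matrix (Fin N) (Fin N) ℂ) (specialUnitaryUnits (Fin N)) R₁ R₂ x).Reg336 c α₀ U → Thm33G0 (𝔬12 x) 1 (H x) B12₀ δ12₀ U)
    (hG0D : ∀ x : MemberY θ.d₆ θ.ℓ₆ θ.hd' θ.hL' θ.b₀ θ.b₁ Mstar, M₀ ≤ (geo9Y x).M → ∀ α₀ : ℝ, 0 < α₀ → (geo9Y x).M * α₀ ≤ a₀ → ∀ U : (bg9YR (Matrix (Fin N) (Fin N) ℂ) (specialUnitaryUnits (Fin N)) R₁ R₂ x).Cfg, (bg9YR (Matrix (Fin N) (Fin N) ℂ) (specialUnitaryUnits (Fin N)) R₁ R₂ x).Reg335 c α₀ U →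
      (bg9YR (Matrix (Fin N) (Fin N) ℂ) (specialUnitaryUnits (Fin N)) R₁ R₂ x).Reg336 c α₀ U → Thm33G0Dir (𝔬12 x) (𝔭A x) (𝔡A x).Dd (𝔡A x).Dsd 1 (H x) (bHXA x) B12₀ Bh12 Bi12 Bi2₁₂ δ12₀ U)
    (hG0DR : ∀ x : MemberY θ.d₆ θ.ℓ₆ θ.hd' θ.hL' θ.b₀ θ.b₁ Mstar, M₀ ≤ (geo9Y x).M → ∀ α₀ : ℝ, 0 < α₀ → (geo9Y x).M * α₀ ≤ a₀ → ∀ U : (bg9YR (Matrix (Fin N) (Fin N) ℂ) (specialUnitaryUnits (Fin N)) R₁ R₂ x).Cfg, (bg9YR (Matrix (Fin N) (Fin N) ℂ) (specialUnitaryUnits (Fin N)) R₁ R₂ x).Reg335 c α₀ U →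
      (bg9YR (Matrix (Fin N) (Fin N) ℂ) (specialUnitaryUnits (Fin N)) R₁ R₂ x).Reg336 c α₀ U → Thm33G0DirR (𝔬12 x) (𝔡A x).Dsd 1 (H x) B12₀ δ12₀ U)
    (hG0L2M : ∀ x : MemberY θ.d₆ θ.ℓ₆ θ.hd' θ.hL' θ.b₀ θ.b₁ Mstar, M₀ ≤ (geo9Y x).M → ∀ α₀ : ℝ, 0 < α₀ → (geo9Y x).M * α₀ ≤ a₀ → ∀ U : (bg9YR (Matrix (Fin N) (Fin N) ℂ) (specialUnitaryUnits (Fin N)) R₁ R₂ x).Cfg, (bg9YR (Matrix (Fin N) (Fin N) ℂ) (specialUnitaryUnits (Fin N)) R₁ R₂ x).Reg335 c α₀ U →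
      (bg9YR (Matrix (Fin N) (Fin N) ℂ) (specialUnitaryUnits (Fin N)) R₁ R₂ x).Reg336 c α₀ U → Thm33G0L2M (𝔬12 x) (𝔡A x).Dd (𝔡A x).Dsd 1 (H x) B12₂ δ12₀ U)
    (he1 : ∀ x : MemberY θ.d₆ θ.ℓ₆ θ.hd' θ.hL' θ.b₀ θ.b₁ Mstar, M₀ ≤ (geo9Y x).M → ∀ α₀ : ℝ, 0 < α₀ → (geo9Y x).M * α₀ ≤ a₀ → ∀ U : (bg9YR (Matrix (Fin N) (Fin N) ℂ) (specialUnitaryUnits (Fin N)) R₁ R₂ x).Cfg, (bg9YR (Matrix (Fin N) (Fin N) ℂ) (specialUnitaryUnits (Fin N)) R₁ R₂ x).Reg335 c α₀ U → (bg9YR (Matrix (Fin N) (Fin N) ℂ) (specialUnitaryUnits (Fin N)) R₁ R₂ x).Reg336 c α₀ U →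
      HasMajorantHom (g := toB6 (geo9Y x) 1 (H x)) (𝔬12 x).blk (𝔬12 x).blkY ((𝔬12 x).D U ∘ₗ (𝔬12 x).G0 U) (fun (a b : (geo9Y x).Site) => B12₀ * (geo9Y x).len a * Real.exp (-(δ12₀ * (geo9Y x).dist a b))))
    (hG0CT : ∀ x : MemberY θ.d₆ θ.ℓ₆ θ.hd' θ.hL' θ.b₀ θ.b₁ Mstar, M₀ ≤ (geo9Y x).M → ∀ α₀ : ℝ, 0 < α₀ → (geo9Y x).M * α₀ ≤ a₀ → ∀ U : (bg9YR (Matrix (Fin N) (Fin N) ℂ) (specialUnitaryUnits (Fin N)) R₁ R₂ x).Cfg, (bg9YR (Matrix (Fin N) (Fin N) ℂ) (specialUnitaryUnits (Fin N)) R₁ R₂ x).Reg335 c α₀ U →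
      (bg9YR (Matrix (Fin N) (Fin N) ℂ) (specialUnitaryUnits (Fin N)) R₁ R₂ x).Reg336 c α₀ U → Thm33G0Dir (𝔬12 x) (𝔭A x) (𝔡A x).Dd (𝔡A x).Dsd 1 (H x) (bHXTA x U) B0T BhT BiT Bi2T δ12₀ U)
    -- print's (3.32) plaquette budget and rows 19's G₀-twin letters `h45X h44m h45Y` (dag-n06-c `h44m_h45X_h45Y_of_local3107`), inputs of the (3.46) legs `hXd ∕ dgDH ∕ pYDH`
    (hF : ∀ x : MemberY θ.d₆ θ.ℓ₆ θ.hd' θ.hL' θ.b₀ θ.b₁ Mstar, letI : Fintype (geo9K x.toKIdx).Site := (inferInstance : Fintype (geo9Y x).Site); M₀ ≤ (geo9Y x).M → ∀ α₀ : ℝ, 0 < α₀ → (geo9Y x).M * α₀ ≤ a₀ → ∀ U : (bg9YR (Matrix (Fin N) (Fin N) ℂ) (specialUnitaryUnits (Fin N)) R₁ R₂ x).Cfg, (bg9YR (Matrix (Fin N) (Fin N) ℂ) (specialUnitaryUnits (Fin N)) R₁ R₂ x).Reg335 c α₀ U →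
      (bg9YR (Matrix (Fin N) (Fin N) ℂ) (specialUnitaryUnits (Fin N)) R₁ R₂ x).Reg336 c α₀ U → ∀ (y : Site (PV θ.d₆ θ.ℓ₆ x.m x.K θ.hd' θ.hL') 0) (μ' ν' : Fin (θ.d₆ + 1)),
        ‖(plaqV U y μ' ν' : Matrix (Fin N) (Fin N) ℂ) - 1‖ ≤ ϑF * (((((θ.ℓ₆ + 1 : ℕ) : ℝ)) ^ levY x.toKIdx (chartY x.toKIdx y))⁻¹))
    (h45X : ∀ x : MemberY θ.d₆ θ.ℓ₆ θ.hd' θ.hL' θ.b₀ θ.b₁ Mstar, letI : Fintype (geo9K x.toKIdx).Site := (inferInstance : Fintype (geo9Y x).Site); M₀ ≤ (geo9Y x).M → ∀ α₀ : ℝ, 0 < α₀ → (geo9Y x).M * α₀ ≤ a₀ → ∀ U : (bg9YR (Matrix (Fin N) (Fin N) ℂ) (specialUnitaryUnits (Fin N)) R₁ R₂ x).Cfg, (bg9YR (Matrix (Fin N) (Fin N) ℂ) (specialUnitaryUnits (Fin N)) R₁ R₂ x).Reg335 c α₀ U →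
      (bg9YR (Matrix (Fin N) (Fin N) ℂ) (specialUnitaryUnits (Fin N)) R₁ R₂ x).Reg336 c α₀ U → ∀ (ν μ : Fin (θ.d₆ + 1)) (β' : ℝ) (h0 : 0 ≤ β') (h1 : β' < 1),
        HasMaj (bHZKP (κ := TrIdx N) x.toKIdx (trBasis N) (taxiB x.toKIdx (bg9YR (Matrix (Fin N) (Fin N) ℂ) (specialUnitaryUnits (Fin N)) R₁ R₂ x) (fun U => U) U) (R := (1 : ℝ)) (H := H x) (hsch0 β' h0 h1).le (hsch1 β' h0 h1).le) (cNormR 1 (H x) (𝔭A x).blkPX (fun y => (geo9Y_len_pos x y).le) (β' - 1))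
          ((𝔭A x).ΦX U β' ∘ₗ ((𝔡A x).Dd U ν ∘ₗ ((𝔬12 x).G0 U ∘ₗ (𝔡A x).Dsd U μ)))
          (fun a a' => BZ β' * Real.exp (-(δ45 * (geo9Y x).dist a a'))))
    (h44m : ∀ x : MemberY θ.d₆ θ.ℓ₆ θ.hd' θ.hL' θ.b₀ θ.b₁ Mstar, letI : Fintype (geo9K x.toKIdx).Site := (inferInstance : Fintype (geo9Y x).Site); M₀ ≤ (geo9Y x).M → ∀ α₀ : ℝ, 0 < α₀ → (geo9Y x).M * α₀ ≤ a₀ → ∀ U : (bg9YR (Matrix (Fin N) (Fin N) ℂ) (specialUnitaryUnits (Fin N)) R₁ R₂ x).Cfg, (bg9YR (Matrix (Fin N) (Fin N) ℂ) (specialUnitaryUnits (Fin N)) R₁ R₂ x).Reg335 c α₀ U →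
      (bg9YR (Matrix (Fin N) (Fin N) ℂ) (specialUnitaryUnits (Fin N)) R₁ R₂ x).Reg336 c α₀ U → ∀ ν μ : Fin (θ.d₆ + 1),
        HasMaj (bHZKP (κ := TrIdx N) x.toKIdx (trBasis N) (taxiB x.toKIdx (bg9YR (Matrix (Fin N) (Fin N) ℂ) (specialUnitaryUnits (Fin N)) R₁ R₂ x) (fun U => U) U) (R := (1 : ℝ)) (H := H x) hs440.le hs441.le) (cNorm 1 (H x) (𝔬12 x).blk (fun y => (geo9Y_len_pos x y).le) 1)
          ((𝔡A x).Dd U ν ∘ₗ ((𝔬12 x).G0 U ∘ₗ (𝔡A x).Dsd U μ)) (fun a a' => Bi44 * Real.exp (-(δ44 * (geo9Y x).dist a a'))))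
    (h45Y : ∀ x : MemberY θ.d₆ θ.ℓ₆ θ.hd' θ.hL' θ.b₀ θ.b₁ Mstar, letI : Fintype (geo9K x.toKIdx).Site := (inferInstance : Fintype (geo9Y x).Site); M₀ ≤ (geo9Y x).M → ∀ α₀ : ℝ, 0 < α₀ → (geo9Y x).M * α₀ ≤ a₀ → ∀ U : (bg9YR (Matrix (Fin N) (Fin N) ℂ) (specialUnitaryUnits (Fin N)) R₁ R₂ x).Cfg, (bg9YR (Matrix (Fin N) (Fin N) ℂ) (specialUnitaryUnits (Fin N)) R₁ R₂ x).Reg335 c α₀ U →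
      (bg9YR (Matrix (Fin N) (Fin N) ℂ) (specialUnitaryUnits (Fin N)) R₁ R₂ x).Reg336 c α₀ U → ∀ (β' : ℝ) (h0 : 0 ≤ β') (h1 : β' < 1) (μ : Fin (θ.d₆ + 1)),
        HasMaj (bHZKP (κ := TrIdx N) x.toKIdx (trBasis N) (taxiB x.toKIdx (bg9YR (Matrix (Fin N) (Fin N) ℂ) (specialUnitaryUnits (Fin N)) R₁ R₂ x) (fun U => U) U) (R := (1 : ℝ)) (H := H x) (hsch0 β' h0 h1).le (hsch1 β' h0 h1).le) (cNormR 1 (H x) (𝔭A x).blkPY (fun y => (geo9Y_len_pos x y).le) (β' - 1))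
          ((𝔭A x).ΦY U β' ∘ₗ ((𝔬12 x).D U ∘ₗ ((𝔬12 x).G0 U ∘ₗ (𝔡A x).Dsd U μ)))
          (fun a a' => BiY β' * Real.exp (-(δ45Y * (geo9Y x).dist a a'))))
    -- §3 (post-chain, byte-budget merge): the SECOND U8 layer's LEG margin `τR` ∕ budget `hR8a … hR8k`, the block-L² step's (3.46) letter + smallness numerics, the Δ⁽²⁾ symmetry schema, the identities-of-form schema, two pins
    {τR : ℝ} (hτR : 0 < τR)
    (hR8a : δ13 + 5 * τR + 3 * σ + 4 * τ ≤ δ₀) (hR8b : δ13 + 5 * τR + 3 * σ + 4 * τ ≤ δ49) (hR8c : δ13 + 5 * τR + 3 * σ + 4 * τ ≤ δ₂) (hR8d : δ13 + 5 * τR + 3 * σ + 5 * τ ≤ δ44G) (hR8e : δ13 + 5 * τR + 3 * σ + 4 * τ ≤ δB) (hR8f : δ13 + 5 * τR + 2 * σ + τ ≤ δ43)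
    (hR8g : δ13 + 5 * τR + τ + σ ≤ δT) (hR8h : δ13 + 5 * τR + 2 * σ + 3 * τ < δ12₀) (hR8i : δ13 + 5 * τR + 2 * σ + 3 * τ < δ44) (hR8j : δ13 + 5 * τR + 2 * σ + 3 * τ < δ45) (hR8k : δ13 + 5 * τR + 2 * σ + 3 * τ < δ45Y)
    (q : PinPrims) (hq : q.OK) {B₄ δ₄ rS : ℝ} (hB₄ : 0 ≤ B₄) (hrS0 : rS ≤ δ₀) (hrSP : rS ≤ δ49) (hrSB : rS ≤ δB) (hrS4 : rS ≤ δ₄) (hrS2 : rS ≤ δ₂) (hKT : δK ≤ δT) (hδTr : δT + 3 * σ + 3 * (q.αF * ((1 - 2 * q.α) * q.δ₀)) ≤ rS)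
    (h46 : ∀ x : MemberY θ.d₆ θ.ℓ₆ θ.hd' θ.hL' θ.b₀ θ.b₁ Mstar, M₀ ≤ (geo9Y x).M → ∀ α₀ : ℝ, 0 < α₀ → (geo9Y x).M * α₀ ≤ a₀ → ∀ U : (bg9YR (Matrix (Fin N) (Fin N) ℂ) (specialUnitaryUnits (Fin N)) R₁ R₂ x).Cfg, (bg9YR (Matrix (Fin N) (Fin N) ℂ) (specialUnitaryUnits (Fin N)) R₁ R₂ x).Reg335 c α₀ U → B9SectDL2Decay.BlockBd (g := toB6 (geo9Y x) 1 (H x)) (𝔬12 x).blk (𝔬12 x).blk (DvcoKH x.toKIdx (trBasis N) (bg9YR (Matrix (Fin N) (Fin N) ℂ) (specialUnitaryUnits (Fin N)) R₁ R₂ x) (fun U => U) U ∘ₗ GcoS x.toKIdx (trBasis N) (bg9YR (Matrix (Fin N) (Fin N) ℂ) (specialUnitaryUnits (Fin N)) R₁ R₂ x) (fun U => U) (GpY x.toKIdx (parSymY x.toKIdx)) U ∘ₗ DvscoKH x.toKIdx (trBasis N) (bg9YR (Matrix (Fin N) (Fin N) ℂ) (specialUnitaryUnits (Fin N)) R₁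 R₂ x) (fun U => U) U) (fun (y y' : (geo9Y x).Site) => B₄ * Real.exp (-(δ₄ * (geo9Y x).dist y y'))))
    (hΔ2 : ∀ (x : MemberY θ.d₆ θ.ℓ₆ θ.hd' θ.hL' θ.b₀ θ.b₁ Mstar) (U : (bg9YR (Matrix (Fin N) (Fin N) ℂ) (specialUnitaryUnits (Fin N)) R₁ R₂ x).Cfg), (∀ μ z, U μ z ∈ specialUnitaryUnits (Fin N)) → IsSymmTr (fun _ => (1 : ℝ)) (Δ2 x U))
    (hIdOfForm : ∀ x : MemberY θ.d₆ θ.ℓ₆ θ.hd' θ.hL' θ.b₀ θ.b₁ Mstar, M₀ ≤ (geo9Y x).M → ∀ α₀ : ℝ, 0 < α₀ → (geo9Y x).M * α₀ ≤ a₀ → ∀ U : (bg9YR (Matrix (Fin N) (Fin N) ℂ) (specialUnitaryUnits (Fin N)) R₁ R₂ x).Cfg, (bg9YR (Matrix (Fin N) (Fin N) ℂ) (specialUnitaryUnits (Fin N)) R₁ R₂ x).Reg335 c α₀ U →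
      (bg9YR (Matrix (Fin N) (Fin N) ℂ) (specialUnitaryUnits (Fin N)) R₁ R₂ x).Reg336 c α₀ U → ∀ r : ℝ, r < 1 → FormSmall (𝔬12 x) r U → B9Thm312Whole.Identities (𝔬12 x) U)
    (hBi2₁₂ : ∀ ε β', 0 < ε → ε ≤ 1 → 0 ≤ β' → β' < 1 → 0 ≤ Bi2₁₂ ε β')
    (hRco12 : ∀ (x : MemberY θ.d₆ θ.ℓ₆ θ.hd' θ.hL' θ.b₀ θ.b₁ Mstar) (U : (bg9YR (Matrix (Fin N) (Fin N) ℂ) (specialUnitaryUnits (Fin N)) R₁ R₂ x).Cfg),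
      (𝔬12 x).R U = RcoK x.toKIdx (trBasis N) (bg9YR (Matrix (Fin N) (Fin N) ℂ) (specialUnitaryUnits (Fin N)) R₁ R₂ x) (fun U => U) (parSymY x.toKIdx) (GpPhysY x.toKIdx (parSymY x.toKIdx)) U)
    -- P-D2 (cut 1, dag-n06-l `d2sup_prechain_v2_of_pins` ✓p764766): the Δ⁽²⁾-free identities and G₀'s positivity ∕ symmetry, the T_π block-L² letter, the G_D road's rates, the Sect.-D pins of S₀ ∕ G ∕ C, print's (3.36) class, [5] (149)'s C⁽²⁾ form letter
    (hinvG0 : ∀ x : MemberY θ.d₆ θ.ℓ₆ θ.hd' θ.hL' θ.b₀ θ.b₁ Mstar, M₀ ≤ (geo9Y x).M → ∀ α₀ : ℝ, 0 < α₀ → (geo9Y x).M * α₀ ≤ a₀ → ∀ U : (bg9YR (Matrix (Fin N) (Fin N) ℂ) (specialUnitaryUnits (Fin N)) R₁ R₂ x).Cfg, (bg9YR (Matrix (Fin N) (Fin N) ℂ) (specialUnitaryUnits (Fin N)) R₁ R₂ x).Reg335 c α₀ U →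
      (bg9YR (Matrix (Fin N) (Fin N) ℂ) (specialUnitaryUnits (Fin N)) R₁ R₂ x).Reg336 c α₀ U → (𝔬12 x).G0 U * (𝔬12 x).S0 U = 1)
    (hpos12 : ∀ x : MemberY θ.d₆ θ.ℓ₆ θ.hd' θ.hL' θ.b₀ θ.b₁ Mstar, M₀ ≤ (geo9Y x).M → ∀ α₀ : ℝ, 0 < α₀ → (geo9Y x).M * α₀ ≤ a₀ → ∀ U : (bg9YR (Matrix (Fin N) (Fin N) ℂ) (specialUnitaryUnits (Fin N)) R₁ R₂ x).Cfg, (bg9YR (Matrix (Fin N) (Fin N) ℂ) (specialUnitaryUnits (Fin N)) R₁ R₂ x).Reg335 c α₀ U →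
      (bg9YR (Matrix (Fin N) (Fin N) ℂ) (specialUnitaryUnits (Fin N)) R₁ R₂ x).Reg336 c α₀ U → B9Thm312Whole.PosDefEnd ((𝔬12 x).S0 U))
    (hsym12 : ∀ x : MemberY θ.d₆ θ.ℓ₆ θ.hd' θ.hL' θ.b₀ θ.b₁ Mstar, M₀ ≤ (geo9Y x).M → ∀ α₀ : ℝ, 0 < α₀ → (geo9Y x).M * α₀ ≤ a₀ → ∀ U : (bg9YR (Matrix (Fin N) (Fin N) ℂ) (specialUnitaryUnits (Fin N)) R₁ R₂ x).Cfg, (bg9YR (Matrix (Fin N) (Fin N) ℂ) (specialUnitaryUnits (Fin N)) R₁ R₂ x).Reg335 c α₀ U →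
      (bg9YR (Matrix (Fin N) (Fin N) ℂ) (specialUnitaryUnits (Fin N)) R₁ R₂ x).Reg336 c α₀ U → B9Thm37Glue.IsTransposePair ((𝔬12 x).G0 U) ((𝔬12 x).G0 U))
    {BL0 δL0 t2L δT σF : ℝ} (hBL0 : 0 ≤ BL0) (ht2L : 0 ≤ t2L) (hσF : 0 < σF) (hσF0 : σF ≤ δL0) (hσFT : σF ≤ δT)
    (hl0 : ∀ x : MemberY θ.d₆ θ.ℓ₆ θ.hd' θ.hL' θ.b₀ θ.b₁ Mstar, M₀ ≤ (geo9Y x).M → ∀ α₀ : ℝ, 0 < α₀ → (geo9Y x).M * α₀ ≤ a₀ → ∀ U : (bg9YR (Matrix (Fin N) (Fin N) ℂ) (specialUnitaryUnits (Fin N)) R₁ R₂ x).Cfg, (bg9YR (Matrix (Fin N) (Fin N) ℂ) (specialUnitaryUnits (Fin N)) R₁ R₂ x).Reg335 c α₀ U →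
      (bg9YR (Matrix (Fin N) (Fin N) ℂ) (specialUnitaryUnits (Fin N)) R₁ R₂ x).Reg336 c α₀ U →
        B9SectDL2Decay.BlockBd (g := toB6 (geo9Y x) 1 (H x)) (𝔬12 x).blk (𝔬12 x).blk ((𝔬12 x).G0 U)
          (fun (y y' : (geo9Y x).Site) => BL0 * (geo9Y x).len y * (geo9Y x).len y' * Real.exp (-(δL0 * (geo9Y x).dist y y'))))
    (htpi : ∀ x : MemberY θ.d₆ θ.ℓ₆ θ.hd' θ.hL' θ.b₀ θ.b₁ Mstar, M₀ ≤ (geo9Y x).M → ∀ α₀ : ℝ, 0 < α₀ → (geo9Y x).M * α₀ ≤ a₀ → ∀ U : (bg9YR (Matrix (Fin N) (Fin N) ℂ) (specialUnitaryUnits (Fin N)) R₁ R₂ x).Cfg, (bg9YR (Matrix (Fin N) (Fin N) ℂ) (specialUnitaryUnits (Fin N)) R₁ R₂ x).Reg335 c α₀ U →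
      (bg9YR (Matrix (Fin N) (Fin N) ℂ) (specialUnitaryUnits (Fin N)) R₁ R₂ x).Reg336 c α₀ U →
        B9SectDL2Decay.BlockBd (g := toB6 (geo9Y x) 1 (H x)) (𝔬12 x).blk (𝔬12 x).blk ((𝔬12 x).Tpi U)
          (fun (y y' : (geo9Y x).Site) => t2L * ((geo9Y x).M * α₀) * ((geo9Y x).len y)⁻¹ * ((geo9Y x).len y')⁻¹ * Real.exp (-(δT * (geo9Y x).dist y y'))))
    {ρG : ℝ} (hρG : 0 < ρG) (hρGP : ρG + σ ≤ δP) (hρGK : ρG + 2 * σ ≤ δK)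
    (hS0co12 : ∀ (x : MemberY θ.d₆ θ.ℓ₆ θ.hd' θ.hL' θ.b₀ θ.b₁ Mstar) (U : (bg9YR (Matrix (Fin N) (Fin N) ℂ) (specialUnitaryUnits (Fin N)) R₁ R₂ x).Cfg),
      (𝔬12 x).S0 U = S0coK x.toKIdx (trBasis N) (bg9YR (Matrix (Fin N) (Fin N) ℂ) (specialUnitaryUnits (Fin N)) R₁ R₂ x) (fun U => U) (parSymY x.toKIdx) (parBY x.toKIdx) (GpPhysY x.toKIdx (parSymY x.toKIdx)) U)
    (hGco12 : ∀ (x : MemberY θ.d₆ θ.ℓ₆ θ.hd' θ.hL' θ.b₀ θ.b₁ Mstar) (U : (bg9YR (Matrix (Fin N) (Fin N) ℂ) (specialUnitaryUnits (Fin N)) R₁ R₂ x).Cfg),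
      (𝔬12 x).G U = GcoK x.toKIdx (trBasis N) (bg9YR (Matrix (Fin N) (Fin N) ℂ) (specialUnitaryUnits (Fin N)) R₁ R₂ x) (fun U => U) (GDY x.toKIdx (parSymY x.toKIdx) (parBY x.toKIdx) (GpPhysY x.toKIdx (parSymY x.toKIdx))) U)
    (hCco12 : ∀ (x : MemberY θ.d₆ θ.ℓ₆ θ.hd' θ.hL' θ.b₀ θ.b₁ Mstar) (U : (bg9YR (Matrix (Fin N) (Fin N) ℂ) (specialUnitaryUnits (Fin N)) R₁ R₂ x).Cfg),
      (𝔬12 x).C U = CcoK x.toKIdx (trBasis N) (bg9YR (Matrix (Fin N) (Fin N) ℂ) (specialUnitaryUnits (Fin N)) R₁ R₂ x) (fun U => U) (parSymY x.toKIdx) (parBY x.toKIdx) (GpPhysY x.toKIdx (parSymY x.toKIdx)) U)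
    (hRP2 : ∀ (x : MemberY θ.d₆ θ.ℓ₆ θ.hd' θ.hL' θ.b₀ θ.b₁ Mstar) (α₀ : ℝ) (U : (bg9YR (Matrix (Fin N) (Fin N) ℂ) (specialUnitaryUnits (Fin N)) R₁ R₂ x).Cfg), (bg9YR (Matrix (Fin N) (Fin N) ℂ) (specialUnitaryUnits (Fin N)) R₁ R₂ x).Reg336 c α₀ U →
      0 ≤ α₀ ∧ (bg9YP (Matrix (Fin N) (Fin N) ℂ) (specialUnitaryUnits (Fin N)) x).Reg336 c35Y α₀ U)
    {κC δC2 : ℝ} (hκC : 0 ≤ κC) (hgap : δ₂ < δC2)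
    -- cut 1 of LOCATED-D2-CYCLE-2 (prechain v2): `O` IS G_A's inverse, print's (3.35)∕(3.36) classes from the record's, (Thm 3.11) Δ_A's positivity on its own regime, the neighbour count
    (hO : ∀ (x : MemberY θ.d₆ θ.ℓ₆ θ.hd' θ.hL' θ.b₀ θ.b₁ Mstar) (U : CfgY (Matrix (Fin N) (Fin N) ℂ) x.toKIdx), O x U = Ring.inverse (deltaAY x.toKIdx (parSymY x.toKIdx) (parBY x.toKIdx) (GpY x.toKIdx (parSymY x.toKIdx)) U))
    {c' : ℝ} (hY : ∀ (x : MemberY θ.d₆ θ.ℓ₆ θ.hd' θ.hL' θ.b₀ θ.b₁ Mstar) (α₀ : ℝ) (U : CfgY (Matrix (Fin N) (Fin N) ℂ) x.toKIdx), R₁ x c α₀ U → R₂ x c α₀ U →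
      regY335 (Matrix (Fin N) (Fin N) ℂ) (specialUnitaryUnits (Fin N)) x c' α₀ U ∧ regY336 (Matrix (Fin N) (Fin N) ℂ) (specialUnitaryUnits (Fin N)) x c' α₀ U)
    (a311 M311 : ℝ) (ha311 : 0 < a311) (hM311 : 0 < M311)
    (hΔA : ∀ x : MemberY θ.d₆ θ.ℓ₆ θ.hd' θ.hL' θ.b₀ θ.b₁ Mstar, M311 ≤ (geo9Y x).M → ∀ α₀ : ℝ, 0 < α₀ → (geo9Y x).M * α₀ ≤ a311 → ∀ U : (bg9YR (Matrix (Fin N) (Fin N) ℂ) (specialUnitaryUnits (Fin N)) R₁ R₂ x).Cfg, (bg9YR (Matrix (Fin N) (Fin N) ℂ) (specialUnitaryUnits (Fin N)) R₁ R₂ x).Reg335 c α₀ U →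
      PosDefTr (fun _ => (1 : ℝ)) (deltaAY x.toKIdx (parSymY x.toKIdx) (parBY x.toKIdx) (GpY x.toKIdx (parSymY x.toKIdx)) U))
    {mN : ℕ} (hnbr : ∀ (x : MemberY θ.d₆ θ.ℓ₆ θ.hd' θ.hL' θ.b₀ θ.b₁ Mstar) (y : (geo9Y x).Site), (nbr (geo9Y x) ((θ.ℓ₆ : ℝ) + 4) y).card ≤ mN)
    (hC2 : ∀ x : MemberY θ.d₆ θ.ℓ₆ θ.hd' θ.hL' θ.b₀ θ.b₁ Mstar, M₀ ≤ (geo9Y x).M → ∀ α₀ : ℝ, 0 < α₀ → (geo9Y x).M * α₀ ≤ a₀ → ∀ U : (bg9YR (Matrix (Fin N) (Fin N) ℂ) (specialUnitaryUnits (Fin N)) R₁ R₂ x).Cfg, (bg9YR (Matrix (Fin N) (Fin N) ℂ) (specialUnitaryUnits (Fin N)) R₁ R₂ x).Reg335 c α₀ U →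
      (bg9YR (Matrix (Fin N) (Fin N) ℂ) (specialUnitaryUnits (Fin N)) R₁ R₂ x).Reg336 c α₀ U →
        C2FormMaj x.toKIdx (g := geo9Y x) (bI x) (fun c => c) (𝔠 x).form U κC δC2 (fun c => (geo9Y x).len c * (((((θ.ℓ₆ + 1 : ℕ) : ℝ) ^ (θ.d₆ + 1)) ^ lvl x.hN x.D x.hk c)⁻¹)))
    (ht2 : constL2 (cR39 (trBasis N))⁻¹ B₀ CP B₄ (rowConst261 (@geo9Y θ.d₆ θ.ℓ₆ θ.hd' θ.hL' θ.b₀ θ.b₁ Mstar) σ) ((θ.ℓ₆ + 1 : ℕ) : ℝ) * tJ ≤ t2L) (hσFK : σF ≤ δK) :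
    ∃ (MW aD θ₂ : ℝ) (BdT : ℝ → ℝ) (Bd2T : ℝ → ℝ → ℝ) (BdX BhD13 : ℝ → ℝ) (BZv : ℝ) (BXv : ℝ → ℝ) (BLv KX Bz Bxz : ℝ) (θS θD A₀S AW AQ AD AQ1 CR : ℝ) (θH AI AV : ℝ → ℝ) (r12 MF aF MR aR : ℝ) (Br : ℝ → ℝ → ℝ),
      M₀ ≤ MW ∧ 0 < aD ∧ aD ≤ a₀ ∧ 0 ≤ θ₂ ∧ (∀ ε, 0 < ε → 0 ≤ BdT ε) ∧ (∀ ε β', 0 < ε → 0 ≤ β' → β' < 1 → 0 ≤ Bd2T ε β') ∧ (∀ β', 0 ≤ β' → β' < 1 → 0 ≤ BdX β') ∧ (∀ β', 0 ≤ β' → β' < 1 → 0 ≤ BhD13 β') ∧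
      0 ≤ BZv ∧ (∀ β', 0 ≤ β' → β' < 1 → 0 ≤ BXv β') ∧ 0 ≤ BLv ∧ 0 ≤ KX ∧ 0 ≤ Bz ∧ 0 ≤ Bxz ∧
      0 ≤ θS ∧ 0 ≤ θD ∧ (∀ β, 0 ≤ β → β < 1 → 0 ≤ θH β) ∧ 0 ≤ A₀S ∧ 0 ≤ AW ∧ 0 ≤ AQ ∧ 0 ≤ AD ∧ 0 ≤ AQ1 ∧ 0 ≤ CR ∧ (∀ ε, 0 < ε → 0 ≤ AI ε) ∧ (∀ ε, 0 < ε → 0 ≤ AV ε) ∧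
      -- (1) dag-n06-c UNIT D: the gradient letters ∇_{U,ν}G₀∇_U ∕ Φ^X_β∇_{U,ν}G₀∇_U out of the transported site class `bHXT x U ε`
      (∀ x : MemberY θ.d₆ θ.ℓ₆ θ.hd' θ.hL' θ.b₀ θ.b₁ Mstar, MW ≤ (geo9Y x).M → ∀ α₀ : ℝ, 0 < α₀ → (geo9Y x).M * α₀ ≤ a₀ →
        ∀ U : (bg9YR (Matrix (Fin N) (Fin N) ℂ) (specialUnitaryUnits (Fin N)) R₁ R₂ x).Cfg, (bg9YR (Matrix (Fin N) (Fin N) ℂ) (specialUnitaryUnits (Fin N)) R₁ R₂ x).Reg335 c α₀ U →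
          (bg9YR (Matrix (Fin N) (Fin N) ℂ) (specialUnitaryUnits (Fin N)) R₁ R₂ x).Reg336 c α₀ U →
            (∀ (ν : Fin (θ.d₆ + 1)) (ε : ℝ), 0 < ε →
              HasMaj (bHXT x U ε) (BlockNorm.ofBlocks (toB6 (geo9Y x) 1 (H x)) (𝔬12 x).blk) ((𝔡A x).Dd U ν ∘ₗ ((𝔬12 x).G0 U ∘ₗ (𝔬12 x).Dv U))
                (fun (a a' : (geo9Y x).Site) => BdT ε * Real.exp (-(δ13 * (geo9Y x).dist a a')))) ∧
            (∀ (ν : Fin (θ.d₆ + 1)) (ε β' : ℝ), 0 < ε → 0 ≤ β' → β' < 1 →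
              HasMaj (bHXT x U (β' + ε)) (BlockNorm.ofBlocks (toB6 (geo9Y x) 1 (H x)) (𝔭A x).blkPX) (((𝔭A x).ΦX U β' ∘ₗ (𝔡A x).Dd U ν) ∘ₗ ((𝔬12 x).G0 U ∘ₗ (𝔬12 x).Dv U))
                (fun (a a' : (geo9Y x).Site) => Bd2T ε β' * (geo9Y x).len a ^ (-β') * Real.exp (-(δ13 * (geo9Y x).dist a a'))))) ∧
      -- (2)–(4) the (3.46) letters at the site Hölder class `bH13 x U`: Φ^X∇_νG₀∇ (`hXd`), ∇_νG₀∇ ∕ ∇G₀∇ (`hdgDHd ∕ hdgDH`), Φ^Y∇G₀∇ (`hYd`)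
      (∀ x : MemberY θ.d₆ θ.ℓ₆ θ.hd' θ.hL' θ.b₀ θ.b₁ Mstar, MW ≤ (geo9Y x).M → ∀ α₀ : ℝ, 0 < α₀ → (geo9Y x).M * α₀ ≤ a₀ →
        ∀ U : (bg9YR (Matrix (Fin N) (Fin N) ℂ) (specialUnitaryUnits (Fin N)) R₁ R₂ x).Cfg, (bg9YR (Matrix (Fin N) (Fin N) ℂ) (specialUnitaryUnits (Fin N)) R₁ R₂ x).Reg335 c α₀ U →
          (bg9YR (Matrix (Fin N) (Fin N) ℂ) (specialUnitaryUnits (Fin N)) R₁ R₂ x).Reg336 c α₀ U → ∀ (ν : Fin (θ.d₆ + 1)) (β' : ℝ), 0 ≤ β' → β' < 1 →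
            HasMaj (bH13 x U) (cNormR 1 (H x) (𝔭A x).blkPX (fun y => (geo9Y_len_pos x y).le) (β' - 1))
              (((𝔭A x).ΦX U β' ∘ₗ (𝔡A x).Dd U ν ∘ₗ (𝔬12 x).G0 U) ∘ₗ (𝔬12 x).Dv U)
              (fun a a' => BdX β' * Real.exp (-(δ13 * (geo9Y x).dist a a')))) ∧
      (∀ x : MemberY θ.d₆ θ.ℓ₆ θ.hd' θ.hL' θ.b₀ θ.b₁ Mstar, MW ≤ (geo9Y x).M → ∀ α₀ : ℝ, 0 < α₀ → (geo9Y x).M * α₀ ≤ a₀ →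
        ∀ U : (bg9YR (Matrix (Fin N) (Fin N) ℂ) (specialUnitaryUnits (Fin N)) R₁ R₂ x).Cfg, (bg9YR (Matrix (Fin N) (Fin N) ℂ) (specialUnitaryUnits (Fin N)) R₁ R₂ x).Reg335 c α₀ U → (bg9YR (Matrix (Fin N) (Fin N) ℂ) (specialUnitaryUnits (Fin N)) R₁ R₂ x).Reg336 c α₀ U →
          (∀ ν : Fin (θ.d₆ + 1), HasMaj (bH13 x U) (cNorm 1 (H x) (𝔬12 x).blk (fun y => (geo9Y_len_pos x y).le) 1) ((𝔡A x).Dd U ν ∘ₗ (𝔬12 x).G0 U ∘ₗ (𝔬12 x).Dv U)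
              (fun a a' => B₃ * Real.exp (-(δ13 * (geo9Y x).dist a a')))) ∧
          HasMaj (bH13 x U) (cNorm 1 (H x) (𝔬12 x).blkY (fun y => (geo9Y_len_pos x y).le) 1) ((𝔬12 x).D U ∘ₗ (𝔬12 x).G0 U ∘ₗ (𝔬12 x).Dv U)
            (fun a a' => B₃ * Real.exp (-(δ13 * (geo9Y x).dist a a')))) ∧
      (∀ x : MemberY θ.d₆ θ.ℓ₆ θ.hd' θ.hL' θ.b₀ θ.b₁ Mstar, MW ≤ (geo9Y x).M → ∀ α₀ : ℝ, 0 < α₀ → (geo9Y x).M * α₀ ≤ a₀ →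
        ∀ U : (bg9YR (Matrix (Fin N) (Fin N) ℂ) (specialUnitaryUnits (Fin N)) R₁ R₂ x).Cfg, (bg9YR (Matrix (Fin N) (Fin N) ℂ) (specialUnitaryUnits (Fin N)) R₁ R₂ x).Reg335 c α₀ U →
          (bg9YR (Matrix (Fin N) (Fin N) ℂ) (specialUnitaryUnits (Fin N)) R₁ R₂ x).Reg336 c α₀ U → ∀ β' : ℝ, 0 ≤ β' → β' < 1 →
            HasMaj (bH13 x U) (cNormR 1 (H x) (𝔭A x).blkPY (fun y => (geo9Y_len_pos x y).le) (β' - 1))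
              (((𝔭A x).ΦY U β' ∘ₗ (𝔬12 x).D U ∘ₗ (𝔬12 x).G0 U) ∘ₗ (𝔬12 x).Dv U)
              (fun a a' => BhD13 β' * Real.exp (-(δ13 * (geo9Y x).dist a a')))) ∧
      -- (5)–(7) the ∇-letters (`hZ1 hpXDv` + the block-L² words), the Φ^X∇ letter at `KX·Bh12`, dag-n06-l's G₀Q⋆ transfer letters
      (∀ x : MemberY θ.d₆ θ.ℓ₆ θ.hd' θ.hL' θ.b₀ θ.b₁ Mstar, MW ≤ (geo9Y x).M → ∀ α₀ : ℝ, 0 < α₀ → (geo9Y x).M * α₀ ≤ a₀ → ∀ U : (bg9YR (Matrix (Fin N) (Fin N) ℂ) (specialUnitaryUnits (Fin N)) R₁ R₂ x).Cfg, (bg9YR (Matrix (Fin N) (Fin N) ℂ) (specialUnitaryUnits (Fin N)) R₁ R₂ x).Reg335 c α₀ U → (bg9YR (Matrix (Fin N) (Fin N) ℂ) (specialUnitaryUnits (Fin N)) R₁ R₂ x).Reg336 c α₀ U →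
        HasMaj (cNorm 1 (H x) (𝔬12 x).blkW (fun y => (geo9Y_len_pos x y).le) 1) (cNorm 1 (H x) (𝔬12 x).blk (fun y => (geo9Y_len_pos x y).le) 2)
          ((𝔬12 x).G0 U ∘ₗ (𝔬12 x).Dv U) (fun a b => BZv * Real.exp (-(δ13 * (geo9Y x).dist a b))) ∧
        (∀ β' : ℝ, 0 ≤ β' → β' < 1 →
          HasMaj (cNormR 1 (H x) (𝔬12 x).blkW (fun y => (geo9Y_len_pos x y).le) 0) (cNormR 1 (H x) (𝔭A x).blkPX (fun y => (geo9Y_len_pos x y).le) (β' - 1))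
            (((𝔭A x).ΦX U β' ∘ₗ (𝔬12 x).G0 U) ∘ₗ (𝔬12 x).Dv U) (fun a b => BXv β' * Real.exp (-(δ13 * (geo9Y x).dist a b)))) ∧
        BlockBd (g := toB6 (geo9Y x) 1 (H x)) (𝔬12 x).blkW (𝔬12 x).blk ((𝔬12 x).G0 U ∘ₗ (𝔬12 x).Dv U)
          (fun (y y' : (geo9Y x).Site) => BLv * (geo9Y x).len y * Real.exp (-(δ13 * (geo9Y x).dist y y'))) ∧
        BlockBd (g := toB6 (geo9Y x) 1 (H x)) (𝔬12 x).blkW (𝔬12 x).blkY ((𝔬12 x).D U ∘ₗ (𝔬12 x).G0 U ∘ₗ (𝔬12 x).Dv U)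
          (fun (y y' : (geo9Y x).Site) => BLv * Real.exp (-(δ13 * (geo9Y x).dist y y'))) ∧
        (∀ ν : Fin (θ.d₆ + 1), BlockBd (g := toB6 (geo9Y x) 1 (H x)) (𝔬12 x).blkW (𝔬12 x).blk ((𝔡A x).Dd U ν ∘ₗ (𝔬12 x).G0 U ∘ₗ (𝔬12 x).Dv U)
          (fun (y y' : (geo9Y x).Site) => BLv * Real.exp (-(δ13 * (geo9Y x).dist y y'))))) ∧
      (∀ x : MemberY θ.d₆ θ.ℓ₆ θ.hd' θ.hL' θ.b₀ θ.b₁ Mstar, MW ≤ (geo9Y x).M → ∀ α₀ : ℝ, 0 < α₀ → (geo9Y x).M * α₀ ≤ a₀ → ∀ U : (bg9YR (Matrix (Fin N) (Fin N) ℂ) (specialUnitaryUnits (Fin N)) R₁ R₂ x).Cfg, (bg9YR (Matrix (Fin N) (Fin N) ℂ) (specialUnitaryUnits (Fin N)) R₁ R₂ x).Reg335 c α₀ U → (bg9YR (Matrix (Fin N) (Fin N) ℂ) (specialUnitaryUnits (Fin N)) R₁ R₂ x).Reg336 c α₀ U →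
        ∀ β' : ℝ, 0 ≤ β' → β' < 1 →
          HasMaj (cNormR 1 (H x) (𝔬12 x).blkW (fun y => (geo9Y_len_pos x y).le) 0) (cNormR 1 (H x) (𝔭A x).blkPX (fun y => (geo9Y_len_pos x y).le) (β' - 1))
            (((𝔭A x).ΦX U β' ∘ₗ (𝔬12 x).G0 U) ∘ₗ (𝔬12 x).Dv U) (fun a b => KX * Bh12 β' * Real.exp (-(δ13 * (geo9Y x).dist a b)))) ∧
      (∀ x : MemberY θ.d₆ θ.ℓ₆ θ.hd' θ.hL' θ.b₀ θ.b₁ Mstar, MW ≤ (geo9Y x).M → ∀ α₀ : ℝ, 0 < α₀ → (geo9Y x).M * α₀ ≤ a₀ → ∀ U : (bg9YR (Matrix (Fin N) (Fin N) ℂ) (specialUnitaryUnits (Fin N)) R₁ R₂ x).Cfg, (bg9YR (Matrix (Fin N) (Fin N) ℂ) (specialUnitaryUnits (Fin N)) R₁ R₂ x).Reg335 c α₀ U → (bg9YR (Matrix (Fin N) (Fin N) ℂ) (specialUnitaryUnits (Fin N)) R₁ R₂ x).Reg336 c α₀ U →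
        HasMaj (weightNorm (BlockNorm.ofBlocks (toB6 (geo9Y x) 1 (H x)) (𝔬12 x).blkZ) (fun y => (geo9Y x).len y * (fun y => ((((θ.ℓ₆ + 1 : ℕ) : ℝ) ^ (θ.d₆ + 1)) ^ lvl x.hN x.D x.hk y)⁻¹) y) (fun y => (mul_pos (geo9Y_len_pos x y) (plateau_pos x.toKIdx y)).le)) (cNorm 1 (H x) (𝔬12 x).blk (fun y => (geo9Y_len_pos x y).le) 1)
          ((𝔬12 x).G0 U ∘ₗ (𝔬12 x).Qstar U) (fun a b => Bz * Real.exp (-(δ13 * (geo9Y x).dist a b))) ∧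
        (∀ β : ℝ, 0 ≤ β → β < 1 →
          HasMaj (weightNorm (BlockNorm.ofBlocks (toB6 (geo9Y x) 1 (H x)) (𝔬12 x).blkZ) (fun y => (geo9Y x).len y * (fun y => ((((θ.ℓ₆ + 1 : ℕ) : ℝ) ^ (θ.d₆ + 1)) ^ lvl x.hN x.D x.hk y)⁻¹) y) (fun y => (mul_pos (geo9Y_len_pos x y) (plateau_pos x.toKIdx y)).le)) (cNormR 1 (H x) (𝔭A x).blkPX (fun y => (geo9Y_len_pos x y).le) (β - 1))
            (((𝔭A x).ΦX U β ∘ₗ (𝔬12 x).G0 U) ∘ₗ (𝔬12 x).Qstar U) (fun a b => Bxz * Real.exp (-(δ13 * (geo9Y x).dist a b))))) ∧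
      -- (8) the Δ⁽²⁾ letter (3.137) DERIVED (dag-n06-l `d2sup_prechain_of_pins`), on the sub-regime `aD`
      (∀ x : MemberY θ.d₆ θ.ℓ₆ θ.hd' θ.hL' θ.b₀ θ.b₁ Mstar, MW ≤ (geo9Y x).M → ∀ α₀ : ℝ, 0 < α₀ → (geo9Y x).M * α₀ ≤ aD → ∀ U : (bg9YR (Matrix (Fin N) (Fin N) ℂ) (specialUnitaryUnits (Fin N)) R₁ R₂ x).Cfg, (bg9YR (Matrix (Fin N) (Fin N) ℂ) (specialUnitaryUnits (Fin N)) R₁ R₂ x).Reg335 c α₀ U →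
      (bg9YR (Matrix (Fin N) (Fin N) ℂ) (specialUnitaryUnits (Fin N)) R₁ R₂ x).Reg336 c α₀ U →
        HasMajorant (g := toB6 (geo9Y x) 1 (H x)) (𝔬12 x).blk (D2coK x.toKIdx (trBasis N) (bg9YR (Matrix (Fin N) (Fin N) ℂ) (specialUnitaryUnits (Fin N)) R₁ R₂ x) (fun U => U) (Δ2 x) U)
          (fun (a b : (geo9Y x).Site) => θ₂ * ((geo9Y x).M * α₀) * ((geo9Y x).len a ^ 2)⁻¹ * Real.exp (-(δ₂ * (geo9Y x).dist a b)))) ∧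
      -- (9) the U8 state layer at (δK, δP) on the sub-regime `aD`: the four state tuples `hst20 ∧ hst10 ∧ hst21 ∧ hst11`
      (∀ x : MemberY θ.d₆ θ.ℓ₆ θ.hd' θ.hL' θ.b₀ θ.b₁ Mstar, MW ≤ (geo9Y x).M → ∀ α₀ : ℝ, 0 < α₀ → (geo9Y x).M * α₀ ≤ aD → ∀ U : (bg9YR (Matrix (Fin N) (Fin N) ℂ) (specialUnitaryUnits (Fin N)) R₁ R₂ x).Cfg, (bg9YR (Matrix (Fin N) (Fin N) ℂ) (specialUnitaryUnits (Fin N)) R₁ R₂ x).Reg335 c α₀ U →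
      (bg9YR (Matrix (Fin N) (Fin N) ℂ) (specialUnitaryUnits (Fin N)) R₁ R₂ x).Reg336 c α₀ U →
        (StepS (𝔬12 x) (weightNorm (bXH x U) (rwt (geo9Y x) (-1)) (rwt_nonneg (fun y => (geo9Y_len_pos x y).le) (-1))) (θS * ((geo9Y x).M * α₀)) δK U ∧
          (HasMaj (weightNorm (bXH x U) (rwt (geo9Y x) (-1)) (rwt_nonneg (fun y => (geo9Y_len_pos x y).le) (-1))) (cNorm 1 (H x) (𝔬12 x).blkY (fun y => (geo9Y_len_pos x y).le) 1) ((𝔬12 x).D U ∘ₗ (𝔬12 x).G0 U ∘ₗ (𝔬12 x).Tpi U) (fun a b => θD * ((geo9Y x).M * α₀) * Real.exp (-(δK * (geo9Y x).dist a b))) ∧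
            HasMaj (weightNorm (bXH x U) (rwt (geo9Y x) (-1)) (rwt_nonneg (fun y => (geo9Y_len_pos x y).le) (-1))) (cNorm 1 (H x) (𝔬12 x).blkY (fun y => (geo9Y_len_pos x y).le) 1) ((𝔬12 x).D U ∘ₗ (𝔬12 x).G0 U ∘ₗ ((𝔬12 x).Tpi U + (𝔬12 x).T2 U)) (fun a b => θD * ((geo9Y x).M * α₀) * Real.exp (-(δK * (geo9Y x).dist a b)))) ∧
          (∀ β : ℝ, 0 ≤ β → β < 1 →
            HasMaj (weightNorm (bXH x U) (rwt (geo9Y x) (-1)) (rwt_nonneg (fun y => (geo9Y_len_pos x y).le) (-1))) (cNormR 1 (H x) (𝔭A x).blkPY (fun y => (geo9Y_len_pos x y).le) (β - 1)) (((𝔭A x).ΦY U β ∘ₗ (𝔬12 x).D U ∘ₗ (𝔬12 x).G0 U) ∘ₗ (𝔬12 x).Tpi U) (fun a b => θH β * ((geo9Y x).M * α₀) * Real.exp (-(δK * (geo9Y x).dist a b))) ∧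
            HasMaj (weightNorm (bXH x U) (rwt (geo9Y x) (-1)) (rwt_nonneg (fun y => (geo9Y_len_pos x y).le) (-1))) (cNormR 1 (H x) (𝔭A x).blkPY (fun y => (geo9Y_len_pos x y).le) (β - 1)) (((𝔭A x).ΦY U β ∘ₗ (𝔬12 x).D U ∘ₗ (𝔬12 x).G0 U) ∘ₗ ((𝔬12 x).Tpi U + (𝔬12 x).T2 U)) (fun a b => θH β * ((geo9Y x).M * α₀) * Real.exp (-(δK * (geo9Y x).dist a b)))) ∧
          HasMaj (cNorm 1 (H x) (𝔬12 x).blk (fun y => (geo9Y_len_pos x y).le) 0) (weightNorm (bXH x U) (rwt (geo9Y x) (-1)) (rwt_nonneg (fun y => (geo9Y_len_pos x y).le) (-1))) ((𝔬12 x).G0 U) (fun a b => A₀S * Real.exp (-(δP * (geo9Y x).dist a b))) ∧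
          HasMaj (weightNorm (BlockNorm.ofBlocks (toB6 (geo9Y x) 1 (H x)) (𝔬12 x).blkZ) (fun y => ((((θ.ℓ₆ + 1 : ℕ) : ℝ) ^ (θ.d₆ + 1)) ^ lvl x.hN x.D x.hk y)⁻¹) (fun y => (plateau_pos x.toKIdx y).le)) (weightNorm (bXH x U) (rwt (geo9Y x) (-1)) (rwt_nonneg (fun y => (geo9Y_len_pos x y).le) (-1))) ((𝔬12 x).G0 U ∘ₗ (𝔬12 x).Qstar U) (fun a b => AQ * Real.exp (-(δP * (geo9Y x).dist a b))) ∧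
          HasMaj (weightNorm (bXH x U) (rwt (geo9Y x) (-1)) (rwt_nonneg (fun y => (geo9Y_len_pos x y).le) (-1))) (cNormR 1 (H x) (𝔬12 x).blk (fun y => (geo9Y_len_pos x y).le) (-2)) LinearMap.id (fun a b => CR * Real.exp (-(δP * (geo9Y x).dist a b))) ∧
          (weightNorm (bXH x U) (rwt (geo9Y x) (-1)) (rwt_nonneg (fun y => (geo9Y_len_pos x y).le) (-1))).κ ≤ (1 + CLip θ.d₆ θ.ℓ₆) ∧
          (∃ Λ : ℝ, 0 ≤ Λ ∧ ∀ (y : (geo9Y x).Site) (F : XBK (TrIdx N) x.toKIdx → ℝ), (weightNorm (bXH x U) (rwt (geo9Y x) (-1)) (rwt_nonneg (fun y => (geo9Y_len_pos x y).le) (-1))).loc y F ≤ Λ * ∑ q : XBK (TrIdx N) x.toKIdx, |F q|)) ∧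
        (StepS (𝔬12 x) (bXH x U) (θS * ((geo9Y x).M * α₀)) δK U ∧
          (∀ ν : Fin (θ.d₆ + 1),
            HasMaj (bXH x U) (cNormR 1 (H x) (𝔬12 x).blk (fun y => (geo9Y_len_pos x y).le) 0) ((𝔡A x).Dd U ν ∘ₗ (𝔬12 x).G0 U ∘ₗ (𝔬12 x).Tpi U) (fun a b => θD * ((geo9Y x).M * α₀) * Real.exp (-(δK * (geo9Y x).dist a b))) ∧
            HasMaj (bXH x U) (cNormR 1 (H x) (𝔬12 x).blk (fun y => (geo9Y_len_pos x y).le) 0) ((𝔡A x).Dd U ν ∘ₗ (𝔬12 x).G0 U ∘ₗ ((𝔬12 x).Tpi U + (𝔬12 x).T2 U)) (fun a b => θD * ((geo9Y x).M * α₀) * Real.exp (-(δK * (geo9Y x).dist a b)))) ∧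
          (∀ β : ℝ, 0 ≤ β → β < 1 →
            HasMaj (bXH x U) (cNormR 1 (H x) (𝔭A x).blkPX (fun y => (geo9Y_len_pos x y).le) (β - 1)) (((𝔭A x).ΦX U β ∘ₗ (𝔬12 x).G0 U) ∘ₗ (𝔬12 x).Tpi U) (fun a b => θH β * ((geo9Y x).M * α₀) * Real.exp (-(δK * (geo9Y x).dist a b))) ∧
            HasMaj (bXH x U) (cNormR 1 (H x) (𝔭A x).blkPX (fun y => (geo9Y_len_pos x y).le) (β - 1)) (((𝔭A x).ΦX U β ∘ₗ (𝔬12 x).G0 U) ∘ₗ ((𝔬12 x).Tpi U + (𝔬12 x).T2 U)) (fun a b => θH β * ((geo9Y x).M * α₀) * Real.exp (-(δK * (geo9Y x).dist a b)))) ∧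
          (∀ (ν : Fin (θ.d₆ + 1)) (β : ℝ), 0 ≤ β → β < 1 →
            HasMaj (bXH x U) (cNormR 1 (H x) (𝔭A x).blkPX (fun y => (geo9Y_len_pos x y).le) β) (((𝔭A x).ΦX U β ∘ₗ (𝔡A x).Dd U ν ∘ₗ (𝔬12 x).G0 U) ∘ₗ (𝔬12 x).Tpi U) (fun a b => θH β * ((geo9Y x).M * α₀) * Real.exp (-(δK * (geo9Y x).dist a b))) ∧
            HasMaj (bXH x U) (cNormR 1 (H x) (𝔭A x).blkPX (fun y => (geo9Y_len_pos x y).le) β) (((𝔭A x).ΦX U β ∘ₗ (𝔡A x).Dd U ν ∘ₗ (𝔬12 x).G0 U) ∘ₗ ((𝔬12 x).Tpi U + (𝔬12 x).T2 U)) (fun a b => θH β * ((geo9Y x).M * α₀) * Real.exp (-(δK * (geo9Y x).dist a b)))) ∧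
          HasMaj (cNormR 1 (H x) (𝔬12 x).blkY (fun y => (geo9Y_len_pos x y).le) 0) (bXH x U) ((𝔬12 x).G0 U ∘ₗ (𝔬12 x).Dstar U) (fun a b => AD * Real.exp (-(δP * (geo9Y x).dist a b))) ∧
          (∀ (μ : Fin (θ.d₆ + 1)) (ε : ℝ), 0 < ε → HasMaj (bHXA x ε) (bXH x U) ((𝔬12 x).G0 U ∘ₗ (𝔡A x).Dsd U μ) (fun a b => AI ε * Real.exp (-(δP * (geo9Y x).dist a b)))) ∧
          HasMaj (bXH x U) (cNormR 1 (H x) (𝔬12 x).blk (fun y => (geo9Y_len_pos x y).le) (-1)) LinearMap.id (fun a b => CR * Real.exp (-(δP * (geo9Y x).dist a b))) ∧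
          (bXH x U).κ ≤ (1 + CLip θ.d₆ θ.ℓ₆) ∧
          (∃ Λ : ℝ, 0 ≤ Λ ∧ ∀ (y : (geo9Y x).Site) (F : XBK (TrIdx N) x.toKIdx → ℝ), (bXH x U).loc y F ≤ Λ * ∑ q : XBK (TrIdx N) x.toKIdx, |F q|)) ∧
        (StepS (𝔬12 x) (weightNorm (bXH x U) (rwt (geo9Y x) (-1)) (rwt_nonneg (fun y => (geo9Y_len_pos x y).le) (-1))) (θS * ((geo9Y x).M * α₀)) δK U ∧
          HasMaj (weightNorm (bXH x U) (rwt (geo9Y x) (-1)) (rwt_nonneg (fun y => (geo9Y_len_pos x y).le) (-1))) (cNorm 1 (H x) (𝔬12 x).blkY (fun y => (geo9Y_len_pos x y).le) 1) ((𝔬12 x).D U ∘ₗ (𝔬12 x).G0 U ∘ₗ ((𝔬12 x).Tpi U + (𝔬12 x).T2 U)) (fun a b => θD * ((geo9Y x).M * α₀) * Real.exp (-(δK * (geo9Y x).dist a b))) ∧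
          (∀ ν : Fin (θ.d₆ + 1), HasMaj (weightNorm (bXH x U) (rwt (geo9Y x) (-1)) (rwt_nonneg (fun y => (geo9Y_len_pos x y).le) (-1))) (cNorm 1 (H x) (𝔬12 x).blk (fun y => (geo9Y_len_pos x y).le) 1) ((𝔡A x).Dd U ν ∘ₗ (𝔬12 x).G0 U ∘ₗ ((𝔬12 x).Tpi U + (𝔬12 x).T2 U)) (fun a b => θD * ((geo9Y x).M * α₀) * Real.exp (-(δK * (geo9Y x).dist a b)))) ∧
          (∀ β : ℝ, 0 ≤ β → β < 1 → HasMaj (weightNorm (bXH x U) (rwt (geo9Y x) (-1)) (rwt_nonneg (fun y => (geo9Y_len_pos x y).le) (-1))) (cNormR 1 (H x) (𝔭A x).blkPY (fun y => (geo9Y_len_pos x y).le) (β - 1)) (((𝔭A x).ΦY U β ∘ₗ (𝔬12 x).D U ∘ₗ (𝔬12 x).G0 U) ∘ₗ ((𝔬12 x).Tpi U + (𝔬12 x).T2 U)) (fun a b => θH β * ((geo9Y x).M * α₀) * Real.exp (-(δK * (geo9Y x).dist a b)))) ∧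
          (∀ (ν : Fin (θ.d₆ + 1)) (β : ℝ), 0 ≤ β → β < 1 → HasMaj (weightNorm (bXH x U) (rwt (geo9Y x) (-1)) (rwt_nonneg (fun y => (geo9Y_len_pos x y).le) (-1))) (cNormR 1 (H x) (𝔭A x).blkPX (fun y => (geo9Y_len_pos x y).le) (β - 1)) (((𝔭A x).ΦX U β ∘ₗ (𝔡A x).Dd U ν ∘ₗ (𝔬12 x).G0 U) ∘ₗ ((𝔬12 x).Tpi U + (𝔬12 x).T2 U)) (fun a b => θH β * ((geo9Y x).M * α₀) * Real.exp (-(δK * (geo9Y x).dist a b)))) ∧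
          HasMaj (cNorm 1 (H x) (𝔬12 x).blk (fun y => (geo9Y_len_pos x y).le) 0) (weightNorm (bXH x U) (rwt (geo9Y x) (-1)) (rwt_nonneg (fun y => (geo9Y_len_pos x y).le) (-1))) ((𝔬12 x).G0 U) (fun a b => A₀S * Real.exp (-(δP * (geo9Y x).dist a b))) ∧
          HasMaj (cNorm 1 (H x) (𝔬12 x).blkW (fun y => (geo9Y_len_pos x y).le) 1) (weightNorm (bXH x U) (rwt (geo9Y x) (-1)) (rwt_nonneg (fun y => (geo9Y_len_pos x y).le) (-1))) ((𝔬12 x).G0 U ∘ₗ (𝔬12 x).Dv U) (fun a b => AW * Real.exp (-(δP * (geo9Y x).dist a b))) ∧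
          HasMaj (weightNorm (BlockNorm.ofBlocks (toB6 (geo9Y x) 1 (H x)) (𝔬12 x).blkZ) (fun y => ((((θ.ℓ₆ + 1 : ℕ) : ℝ) ^ (θ.d₆ + 1)) ^ lvl x.hN x.D x.hk y)⁻¹) (fun y => (plateau_pos x.toKIdx y).le)) (weightNorm (bXH x U) (rwt (geo9Y x) (-1)) (rwt_nonneg (fun y => (geo9Y_len_pos x y).le) (-1))) ((𝔬12 x).G0 U ∘ₗ (𝔬12 x).Qstar U) (fun a b => AQ * Real.exp (-(δP * (geo9Y x).dist a b))) ∧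
          HasMaj (weightNorm (bXH x U) (rwt (geo9Y x) (-1)) (rwt_nonneg (fun y => (geo9Y_len_pos x y).le) (-1))) (cNormR 1 (H x) (𝔬12 x).blk (fun y => (geo9Y_len_pos x y).le) (-2)) LinearMap.id (fun a b => CR * Real.exp (-(δP * (geo9Y x).dist a b))) ∧
          (∃ Λ : ℝ, 0 ≤ Λ ∧ ∀ (y : (geo9Y x).Site) (F : XBK (TrIdx N) x.toKIdx → ℝ), (weightNorm (bXH x U) (rwt (geo9Y x) (-1)) (rwt_nonneg (fun y => (geo9Y_len_pos x y).le) (-1))).loc y F ≤ Λ * ∑ q : XBK (TrIdx N) x.toKIdx, |F q|)) ∧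
        (StepS (𝔬12 x) (bXH x U) (θS * ((geo9Y x).M * α₀)) δK U ∧
          (∀ ν : Fin (θ.d₆ + 1), HasMaj (bXH x U) (cNormR 1 (H x) (𝔬12 x).blk (fun y => (geo9Y_len_pos x y).le) 0) ((𝔡A x).Dd U ν ∘ₗ (𝔬12 x).G0 U ∘ₗ ((𝔬12 x).Tpi U + (𝔬12 x).T2 U)) (fun a b => θD * ((geo9Y x).M * α₀) * Real.exp (-(δK * (geo9Y x).dist a b)))) ∧
          (∀ β : ℝ, 0 ≤ β → β < 1 → HasMaj (bXH x U) (cNormR 1 (H x) (𝔭A x).blkPX (fun y => (geo9Y_len_pos x y).le) (β - 1)) (((𝔭A x).ΦX U β ∘ₗ (𝔬12 x).G0 U) ∘ₗ ((𝔬12 x).Tpi U + (𝔬12 x).T2 U)) (fun a b => θH β * ((geo9Y x).M * α₀) * Real.exp (-(δK * (geo9Y x).dist a b)))) ∧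
          (∀ (ν : Fin (θ.d₆ + 1)) (β : ℝ), 0 ≤ β → β < 1 → HasMaj (bXH x U) (cNormR 1 (H x) (𝔭A x).blkPX (fun y => (geo9Y_len_pos x y).le) β) (((𝔭A x).ΦX U β ∘ₗ (𝔡A x).Dd U ν ∘ₗ (𝔬12 x).G0 U) ∘ₗ ((𝔬12 x).Tpi U + (𝔬12 x).T2 U)) (fun a b => θH β * ((geo9Y x).M * α₀) * Real.exp (-(δK * (geo9Y x).dist a b)))) ∧
          HasMaj (cNormR 1 (H x) (𝔬12 x).blkY (fun y => (geo9Y_len_pos x y).le) 0) (bXH x U) ((𝔬12 x).G0 U ∘ₗ (𝔬12 x).Dstar U) (fun a b => AD * Real.exp (-(δP * (geo9Y x).dist a b))) ∧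
          (∀ (μ : Fin (θ.d₆ + 1)) (ε : ℝ), 0 < ε → HasMaj (bHXA x ε) (bXH x U) ((𝔬12 x).G0 U ∘ₗ (𝔡A x).Dsd U μ) (fun a b => AI ε * Real.exp (-(δP * (geo9Y x).dist a b)))) ∧
          (∀ ε : ℝ, 0 < ε → HasMaj (bHXT x U ε) (bXH x U) ((𝔬12 x).G0 U ∘ₗ (𝔬12 x).Dv U) (fun a b => AV ε * Real.exp (-(δP * (geo9Y x).dist a b)))) ∧
          HasMaj (weightNorm (BlockNorm.ofBlocks (toB6 (geo9Y x) 1 (H x)) (𝔬12 x).blkZ) (fun y => (geo9Y x).len y * ((((θ.ℓ₆ + 1 : ℕ) : ℝ) ^ (θ.d₆ + 1)) ^ lvl x.hN x.D x.hk y)⁻¹) (fun y => (mul_pos (geo9Y_len_pos x y) (plateau_pos x.toKIdx y)).le)) (bXH x U) ((𝔬12 x).G0 U ∘ₗ (𝔬12 x).Qstar U) (fun a b => AQ1 * Real.exp (-(δP * (geo9Y x).dist a b))) ∧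
          HasMaj (bXH x U) (cNormR 1 (H x) (𝔬12 x).blk (fun y => (geo9Y_len_pos x y).le) (-1)) LinearMap.id (fun a b => CR * Real.exp (-(δP * (geo9Y x).dist a b))) ∧
          (∃ Λ : ℝ, 0 ≤ Λ ∧ ∀ (y : (geo9Y x).Site) (F : XBK (TrIdx N) x.toKIdx → ℝ), (bXH x U).loc y F ≤ Λ * ∑ q : XBK (TrIdx N) x.toKIdx, |F q|))) ∧
      -- (10) the block-L² step at the DERIVED Δ⁽²⁾ letter, converted to the U8 rate δK, and the L²-step identities ∕ form-smallness (dag-n06-l `formSmall_identities_of_stepL2`)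
      0 ≤ r12 ∧ 0 < aF ∧ aF ≤ aD ∧ MW ≤ MF ∧
      (∀ x : MemberY θ.d₆ θ.ℓ₆ θ.hd' θ.hL' θ.b₀ θ.b₁ Mstar, MF ≤ (geo9Y x).M → ∀ α₀ : ℝ, 0 < α₀ → (geo9Y x).M * α₀ ≤ aD → ∀ U : (bg9YR (Matrix (Fin N) (Fin N) ℂ) (specialUnitaryUnits (Fin N)) R₁ R₂ x).Cfg, (bg9YR (Matrix (Fin N) (Fin N) ℂ) (specialUnitaryUnits (Fin N)) R₁ R₂ x).Reg335 c α₀ U →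
      (bg9YR (Matrix (Fin N) (Fin N) ℂ) (specialUnitaryUnits (Fin N)) R₁ R₂ x).Reg336 c α₀ U → StepL2 (𝔬12 x) 1 (H x) ((t2L + θ₂ * constL2Pi (cR39 (trBasis N))⁻¹ B₀ CP B₄ (rowConst261 (@geo9Y θ.d₆ θ.ℓ₆ θ.hd' θ.hL' θ.b₀ θ.b₁ Mstar) σ) ((θ.ℓ₆ + 1 : ℕ) : ℝ)) * ((geo9Y x).M * α₀)) δK U) ∧
      (∀ x : MemberY θ.d₆ θ.ℓ₆ θ.hd' θ.hL' θ.b₀ θ.b₁ Mstar, MF ≤ (geo9Y x).M → ∀ α₀ : ℝ, 0 < α₀ → (geo9Y x).M * α₀ ≤ aF → ∀ U : (bg9YR (Matrix (Fin N) (Fin N) ℂ) (specialUnitaryUnits (Fin N)) R₁ R₂ x).Cfg, (bg9YR (Matrix (Fin N) (Fin N) ℂ) (specialUnitaryUnits (Fin N)) R₁ R₂ x).Reg335 c α₀ U →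
      (bg9YR (Matrix (Fin N) (Fin N) ℂ) (specialUnitaryUnits (Fin N)) R₁ R₂ x).Reg336 c α₀ U → FormSmall (𝔬12 x) (r12 * ((geo9Y x).M * α₀)) U ∧ B9Thm312Whole.Identities (𝔬12 x) U) ∧
      -- (11) the level-13 letter `hrgdd13` from the SECOND U8 layer above δ13 (`…N06Rgdd13AtPinsPUW.hrgdd13_of_pinsP_geo9Y`), on the sub-regime `aR ≤ aF`
      MF ≤ MR ∧ 0 < aR ∧ aR ≤ aF ∧ (∀ ε ε', 0 < ε' → ε' < 1 → ε' < ε → ε ≤ ε' + 1 → 0 ≤ Br ε ε') ∧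
      ∀ x : MemberY θ.d₆ θ.ℓ₆ θ.hd' θ.hL' θ.b₀ θ.b₁ Mstar, MR ≤ (geo9Y x).M → ∀ α₀ : ℝ, 0 < α₀ → (geo9Y x).M * α₀ ≤ aR →
        ∀ U : (bg9YR (Matrix (Fin N) (Fin N) ℂ) (specialUnitaryUnits (Fin N)) R₁ R₂ x).Cfg, (bg9YR (Matrix (Fin N) (Fin N) ℂ) (specialUnitaryUnits (Fin N)) R₁ R₂ x).Reg335 c α₀ U →
          (bg9YR (Matrix (Fin N) (Fin N) ℂ) (specialUnitaryUnits (Fin N)) R₁ R₂ x).Reg336 c α₀ U →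
            ∀ (μ : Fin (θ.d₆ + 1)) (ε ε' : ℝ), 0 < ε' → ε' < 1 → ε' < ε → ε ≤ ε' + 1 →
              HasMaj (bHXA x ε) (bHXT x U ε') ((𝔬12 x).R U ∘ₗ (𝔬12 x).Dvstar U ∘ₗ (𝔬12 x).G1 U ∘ₗ (𝔡A x).Dsd U μ)
                (fun (a a' : (geo9Y x).Site) => Br ε ε' * Real.exp (-(δ13 * (geo9Y x).dist a a'))) := by
  have hG' : ∀ x : MemberY θ.d₆ θ.ℓ₆ θ.hd' θ.hL' θ.b₀ θ.b₁ Mstar, GeoOK (geo9Y x) := fun x => ⟨geo9Y_dist_triangle x, geo9Y_dist_comm x, geo9K_dist_nonneg x.toKIdx, geo9Y_len_pos x⟩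
  have hδ13 : 0 ≤ δ13 := by linarith only [hP3, hKP, hδK0, hσ, hτ]
  have hN : 0 < N := Nat.pos_of_ne_zero (NeZero.ne N)
  -- §1–§2 FILE L2 (the level-13 letters, the Δ⁽²⁾ letter derived, the U8 state layer) BY NAME
  obtain ⟨MW, aD, θ₂, BdT, Bd2T, BdX, BhD13, BZv, BXv, BLv, KX, Bz, Bxz, θS, θD, A₀S, AW, AQ, AD, AQ1, CR, θH, AI, AV, hMW, haD0, haDa, hθ₂0, hBdT, hBd2T, hBdX, hBhD13, hBZv, hBXv, hBLv, hKX, hBz, hBxz, hθS, hθD, hθH, hA₀S, hAW, hAQ, hAD, hAQ1, hCR, hAI, hAV, hLEG, hXd, hDg, hYd, hDV, hPX, hGT, hD2sup, hST⟩ :=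
    level13_d2_layer_of_pinsP_geo9Y (N := N) (θ := θ) (Mstar := Mstar) (H := H) (bI := bI) (hlev := hlev) (hβ1 := hβ1) (hbI0 := hbI0) (hGR := hGR) (c := c) (hc10 := hc10) (hP := hP) (hM₀ := hM₀) (ha₀ := ha₀) (hσ := hσ) (hτ := hτ) (w13 := w13) (hw13₀ := hw13₀) (hw13₁ := hw13₁) (wX := wX) (hwX₀ := hwX₀) (hwX₁ := hwX₁) (hs440 := hs440) (hs441 := hs441) (hw1344 := hw1344) (hwX44 := hwX44) (sch := sch) (hsch0 := hsch0) (hsch1 := hsch1) (hwsch := hwsch) (bH13 := bH13) (hbH13 := hbH13) (hκ13 := hκ13) (bXH := bXH) (hbXH := hbXH) (bHXA := bHXA) (hbHXA := hbHXA) (bHXT := bHXT) (hbHXT := hbHXT) (bHXTA := bHXTA) (hbHXTA := hbHXTA) (𝔬12 := 𝔬12) (hblk12 := hblk12) (hblkW12 := hblkW12) (hblkY12 := hblkY12) (hblkZ12 := hblkZ12) (O := O) (hG0co12 := hG0co12) (hDco12 := hDco12) (hDsco12 := hDsco12) (𝔠 := 𝔠) (Δ2 := Δ2) (hΔ2def :=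 hΔ2def) (hTpico12 := hTpico12) (hT2co12 := hT2co12) (hDvco12 := hDvco12) (hDvsco12 := hDvsco12) (hQsco12 := hQsco12) (𝔭A := 𝔭A) (hparB := hparB) (h𝔭A := h𝔭A) (𝔬A := 𝔬A) (𝔡A := 𝔡A) (h𝔡Ad := h𝔡Ad) (h𝔡As := h𝔡As) (hB₀ := hB₀) (hCP := hCP) (htJ := htJ) (hB43 := hB43) (htA := htA) (hB44 := hB44) (hB12₀ := hB12₀) (hB12₂ := hB12₂) (hBh12 := hBh12) (hBi12 := hBi12) (hBHG := hBHG) (hwBhG := hwBhG) (hϑF := hϑF) (hBi44 := hBi44) (hBZ := hBZ) (hBiY := hBiY) (hBiT := hBiT) (hBi2T := hBi2T) (hB₃ := hB₃) (hB3d := hB3d) (hB3p := hB3p) (hδK0 := hδK0) (hr0 := hr0) (hr49 := hr49) (hr2 := hr2) (hr44 := hr44) (hrB := hrB) (hr43 := hr43) (hrT := hrT) (hK3d := hK3d) (hKP := hKP) (hP0 := hP0) (hP3 := hP3) (h130 := h130) (h1344 := h1344) (h1345 := h1345) (h1345Y := h1345Y) (h31 := h31) (h49 := h49) (h43 := h43)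 (h44G := h44G) (hta := hta) (hBJ := hBJ) (hG0 := hG0) (hG0D := hG0D) (hG0DR := hG0DR) (hG0L2M := hG0L2M) (he1 := he1) (hG0CT := hG0CT) (hF := hF) (h45X := h45X) (h44m := h44m) (h45Y := h45Y) (hinvG0 := hinvG0) (hpos12 := hpos12) (hsym12 := hsym12) (hBL0 := hBL0) (ht2L := ht2L) (hσF := hσF) (hσF0 := hσF0) (hσFT := hσFT) (hl0 := hl0) (htpi := htpi) (hρG := hρG) (hρGP := hρGP) (hρGK := hρGK) (hS0co12 := hS0co12) (hGco12 := hGco12) (hCco12 := hCco12) (hRP2 := hRP2) (hκC := hκC) (hgap := hgap) (hO := hO) (hY := hY) (a311 := a311) (M311 := M311) (ha311 := ha311) (hM311 := hM311) (hΔA := hΔA) (hnbr := hnbr) (hC2 := hC2)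
  -- §3a the block-L² step at the derived letter (rate δT), on the regime (max (max M₀ 1) MW, aD)
  have hM1 : (0 : ℝ) < max (max M₀ 1) MW := lt_max_of_lt_left (lt_max_of_lt_right one_pos)
  have ht2S : 0 ≤ (t2L + θ₂ * constL2Pi (cR39 (trBasis N))⁻¹ B₀ CP B₄ (rowConst261 (@geo9Y θ.d₆ θ.ℓ₆ θ.hd' θ.hL' θ.b₀ θ.b₁ Mstar) σ) ((θ.ℓ₆ + 1 : ℕ) : ℝ)) := add_nonneg ((mul_nonneg (constL2_nonneg (inv_nonneg.2 (cR39_trBasis_pos hN).le) hB₀ hCP hB₄ (B9RowSum261DefiniteFaces.rowConst261_nonneg _ _) (Nat.cast_nonneg _)) htJ).trans ht2) (mul_nonneg hθ₂0 (constL2Pi_nonneg _ _ _ _ _ _))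
  obtain ⟨MS2, hS2⟩ := stepL2_of_letter_schemas_residualR (N := N) q hq H R₁ R₂ hGR c (fun x => ops312RY (𝔬12 x)) Δ2 B₀ δ₀ CP δ49 tJ δB B₄ δ₄ rS _ σ t2L θ₂ δ₂ (θ₂ * constL2Pi (cR39 (trBasis N))⁻¹ B₀ CP B₄ (rowConst261 (@geo9Y θ.d₆ θ.ℓ₆ θ.hd' θ.hL' θ.b₀ θ.b₁ Mstar) σ) ((θ.ℓ₆ + 1 : ℕ) : ℝ)) (max (max M₀ 1) MW) aD
    hB₀ hCP htJ hB₄ hθ₂0 hσ hM1 hrS0 hrSP hrSB hrS4 hrS2 (hδK0.trans hKT) hδTr ht2 le_rfl hTpico12 hT2co12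
    (fun x hM α₀ hα ha U hU _ => by rw [show (ops312RY (𝔬12 x)).blkW = _ from hblkW12 x, show (ops312RY (𝔬12 x)).blk = _ from hblk12 x]; exact h31 x ((le_max_left M₀ 1).trans ((le_max_left _ MW).trans hM)) α₀ hα (ha.trans haDa) U hU)
    (fun x hM α₀ hα ha U hU _ => h46 x ((le_max_left M₀ 1).trans ((le_max_left _ MW).trans hM)) α₀ hα (ha.trans haDa) U hU)
    (fun x hM α₀ hα ha U hU _ => by rw [show (ops312RY (𝔬12 x)).blkW = _ from hblkW12 x, show (ops312RY (𝔬12 x)).blk = _ from hblk12 x]; exact h49 x ((le_max_left M₀ 1).trans ((le_max_left _ MW).trans hM)) α₀ hα (ha.trans haDa) U hU)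
    (fun x hM α₀ hα ha U hU hU' => hBJ x ((le_max_left M₀ 1).trans ((le_max_left _ MW).trans hM)) α₀ hα (ha.trans haDa) U hU hU')
    (fun x hM α₀ hα ha U hU hU' => B9PerturbationL2Delta2.blockBd_d2coK_of_sup_symm x.toKIdx _ _ _ (hG' x) (mul_nonneg hθ₂0 (mul_nonneg (B9GeoLemma21KLevelV1.geo9K_M_nonneg x.toKIdx) hα.le)) (hD2sup x ((le_max_right _ MW).trans hM) α₀ hα ha U hU hU') (hΔ2 x U (mem_of_reg335R hGR x hU)))
  -- §3b the rate conversion δT → δK (hKT) on the regime (MF0, aD), MF0 := max (max (max M₀ 1) MW) MS2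
  have hstepL2 : ∀ x : MemberY θ.d₆ θ.ℓ₆ θ.hd' θ.hL' θ.b₀ θ.b₁ Mstar, max (max (max M₀ 1) MW) MS2 ≤ (geo9Y x).M → ∀ α₀ : ℝ, 0 < α₀ → (geo9Y x).M * α₀ ≤ aD → ∀ U : (bg9YR (Matrix (Fin N) (Fin N) ℂ) (specialUnitaryUnits (Fin N)) R₁ R₂ x).Cfg, (bg9YR (Matrix (Fin N) (Fin N) ℂ) (specialUnitaryUnits (Fin N)) R₁ R₂ x).Reg335 c α₀ U →
      (bg9YR (Matrix (Fin N) (Fin N) ℂ) (specialUnitaryUnits (Fin N)) R₁ R₂ x).Reg336 c α₀ U → StepL2 (𝔬12 x) 1 (H x) ((t2L + θ₂ * constL2Pi (cR39 (trBasis N))⁻¹ B₀ CP B₄ (rowConst261 (@geo9Y θ.d₆ θ.ℓ₆ θ.hd' θ.hL' θ.b₀ θ.b₁ Mstar) σ) ((θ.ℓ₆ + 1 : ℕ) : ℝ)) * ((geo9Y x).M * α₀)) δK U := fun x hM α₀ hα ha U hU hU' =>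
    (fun (h : StepL2 (ops312RY (𝔬12 x)) 1 (H x) ((t2L + θ₂ * constL2Pi (cR39 (trBasis N))⁻¹ B₀ CP B₄ (rowConst261 (@geo9Y θ.d₆ θ.ℓ₆ θ.hd' θ.hL' θ.b₀ θ.b₁ Mstar) σ) ((θ.ℓ₆ + 1 : ℕ) : ℝ)) * ((geo9Y x).M * α₀)) _ U) (hk : ∀ y y' : (geo9Y x).Site, (t2L + θ₂ * constL2Pi (cR39 (trBasis N))⁻¹ B₀ CP B₄ (rowConst261 (@geo9Y θ.d₆ θ.ℓ₆ θ.hd' θ.hL' θ.b₀ θ.b₁ Mstar) σ) ((θ.ℓ₆ + 1 : ℕ) : ℝ)) * ((geo9Y x).M * α₀) * ((geo9Y x).len y)⁻¹ * ((geo9Y x).len y')⁻¹ * Real.exp (-(_ * (geo9Y x).dist y y')) ≤ (t2L + θ₂ * constL2Pi (cR39 (trBasis N))⁻¹ B₀ CP B₄ (rowConst261 (@geo9Y θ.d₆ θ.ℓ₆ θ.hd' θ.hL' θ.b₀ θ.b₁ Mstar) σ) ((θ.ℓ₆ + 1 : ℕ) : ℝ)) * ((geo9Y x).M * α₀) * ((geo9Y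 x).len y)⁻¹ * ((geo9Y x).len y')⁻¹ * Real.exp (-(δK * (geo9Y x).dist y y'))) => (⟨h.t.mono hk, h.t1.mono hk⟩ : StepL2 (𝔬12 x) 1 (H x) ((t2L + θ₂ * constL2Pi (cR39 (trBasis N))⁻¹ B₀ CP B₄ (rowConst261 (@geo9Y θ.d₆ θ.ℓ₆ θ.hd' θ.hL' θ.b₀ θ.b₁ Mstar) σ) ((θ.ℓ₆ + 1 : ℕ) : ℝ)) * ((geo9Y x).M * α₀)) δK U))
      (hS2 x ((le_max_right _ _).trans hM) ((le_max_left _ _).trans hM) α₀ hα ha U hU hU')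
      (fun y y' => mul_le_mul_of_nonneg_left (Real.exp_le_exp.2 (neg_le_neg (mul_le_mul_of_nonneg_right hKT (geo9K_dist_nonneg x.toKIdx y y')))) (mul_nonneg (mul_nonneg (mul_nonneg ht2S (mul_nonneg (hM₀.trans ((le_max_left M₀ 1).trans ((le_max_left _ MW).trans ((le_max_left _ MS2).trans hM)))) hα.le)) (inv_nonneg.2 (geo9Y_len_pos x y).le)) (inv_nonneg.2 (geo9Y_len_pos x y').le)))
  -- §3c dag-n06-l's identities ∕ form-smallness of the L² step
  have hM0F0 : M₀ ≤ max (max (max M₀ 1) MW) MS2 := (le_max_left M₀ 1).trans ((le_max_left _ MW).trans (le_max_left _ MS2))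
  obtain ⟨r12, MF, aF, hr12, haF0, haFa, hMFL, hFI⟩ := formSmall_identities_of_stepL2 (bg := fun x : MemberY θ.d₆ θ.ℓ₆ θ.hd' θ.hL' θ.b₀ θ.b₁ Mstar => bg9YR (Matrix (Fin N) (Fin N) ℂ) (specialUnitaryUnits (Fin N)) R₁ R₂ x) H 𝔬12 (t2L + θ₂ * constL2Pi (cR39 (trBasis N))⁻¹ B₀ CP B₄ (rowConst261 (@geo9Y θ.d₆ θ.ℓ₆ θ.hd' θ.hL' θ.b₀ θ.b₁ Mstar) σ) ((θ.ℓ₆ + 1 : ℕ) : ℝ)) δL0 δK BL0 aD (max (max (max M₀ 1) MW) MS2) σF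
    haD0 (hM1.trans_le (le_max_left _ _)) ht2S hBL0 hσF hσF0 hσFK
    (fun x hM α₀ hα ha U hU hU' => hsym12 x (hM0F0.trans hM) α₀ hα (ha.trans haDa) U hU hU') (fun x hM α₀ hα ha U hU hU' => hpos12 x (hM0F0.trans hM) α₀ hα (ha.trans haDa) U hU hU')
    (fun x hM α₀ hα ha U hU hU' => hinvG0 x (hM0F0.trans hM) α₀ hα (ha.trans haDa) U hU hU') (fun x hM α₀ hα ha U hU hU' => hl0 x (hM0F0.trans hM) α₀ hα (ha.trans haDa) U hU hU')
    (fun x hM α₀ hα ha U hU hU' => hIdOfForm x (hM0F0.trans hM) α₀ hα (ha.trans haDa) U hU hU') hstepL2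
  have hM0F : M₀ ≤ MF := hM0F0.trans hMFL
  have hMWF : MW ≤ MF := ((le_max_right _ MW).trans (le_max_left _ MS2)).trans hMFL
  have haFa0 : aF ≤ a₀ := haFa.trans haDa
  -- §3d the `hrgdd13` leg on the regime (MF, aF): the SECOND U8 layer above δ13 with LEG margin τR, fed the derived Δ⁽²⁾ letter and the identities
  obtain ⟨MR, aR, Br, hMR, haR0, haRF, hBr, hRG⟩ :=
    hrgdd13_of_pinsP_geo9Y (N := N) θ Mstar H bI hlev hβ1 hbI0 hGR c hc10 hP (hM₀.trans hM0F) haF0 hσ hτ w13 hw13₀ hw13₁ wX hwX₀ hwX₁ hs440 hs441 hw1344 hwX44 sch hsch0 hsch1 hwsch bH13 hbH13 hκ13 bXH hbXH bHXA hbHXA bHXT hbHXT bHXTA hbHXTA 𝔬12 hblk12 hblkW12 hblkY12 hblkZ12 O hG0co12 hDco12 hDsco12 Δ2 hTpico12 hT2co12 hDvco12 hDvsco12 hRco12 hQsco12 𝔭A hparB h𝔭A 𝔬A 𝔡A h𝔡Ad h𝔡As (M₀ := MF) (a₀ := aF) (δ12₃ := δ13) (δK := δ13 + 5 * τR) (δP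 := δ13 + 5 * τR + τ + σ) (δ13 := δ13 + 5 * τR + 2 * σ + 3 * τ) (hB₀ := hB₀) (hCP := hCP) (htJ := htJ) (hB43 := hB43) (htA := htA) (hθ₂ := hθ₂0) (hB44 := hB44) (hB12₀ := hB12₀) (hB12₂ := hB12₂) (hBh12 := hBh12) (hBi12 := hBi12) (hBi2₁₂ := hBi2₁₂) (hBHG := hBHG) (hwBhG := hwBhG) (hϑF := hϑF) (hBi44 := hBi44) (hBZ := hBZ) (hBiY := hBiY) (hBiT := hBiT) (hBi2T := hBi2T) (hδ30 := hδ13) (hτR := hτR) (h3₀ := by linarith only [hR8h, hτR, hσ, hτ]) (h3P := by linarith only [hτR, hσ, hτ]) (h3K := le_rfl) (h349 := by linarith only [hR8b, hτR, hσ, hτ]) (hr0 := hR8a) (hr49 := hR8b) (hr2 := hR8c) (hr44 := hR8d) (hrB := hR8e) (hr43 := hR8f) (hrT := hR8g) (hK3d := by linarith only [hσ, hτ]) (hKP := le_rfl) (hP0 := by linarith only [hR8h, hσ, hτ]) (hP3 := by linarith only [hτ]) (h130 := hR8h) (h1344 := hR8i) (h1345 := hR8j) (h1345Y := hR8k) (h31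 := fun x hM α₀ hα ha => h31 x (hM0F.trans hM) α₀ hα (ha.trans haFa0)) (h49 := fun x hM α₀ hα ha => h49 x (hM0F.trans hM) α₀ hα (ha.trans haFa0)) (h43 := fun x hM α₀ hα ha => h43 x (hM0F.trans hM) α₀ hα (ha.trans haFa0)) (h44G := fun x hM α₀ hα ha => h44G x (hM0F.trans hM) α₀ hα (ha.trans haFa0)) (hD2 := fun x hM α₀ hα ha => hD2sup x (hMWF.trans hM) α₀ hα (ha.trans haFa)) (hta := fun x hM α₀ hα ha => hta x (hM0F.trans hM) α₀ hα (ha.trans haFa0)) (hBJ := fun x hM α₀ hα ha => hBJ x (hM0F.trans hM) α₀ hα (ha.trans haFa0)) (hG0 := fun x hM α₀ hα ha => hG0 x (hM0F.trans hM) α₀ hα (ha.trans haFa0)) (hG0D := fun x hM α₀ hα ha => hG0D x (hM0F.trans hM) α₀ hα (ha.trans haFa0)) (hG0DR := fun x hM α₀ hα ha => hG0DR x (hM0F.trans hM) α₀ hα (ha.trans haFa0)) (hG0L2M := fun x hM α₀ hα ha => hG0L2M x (hM0F.trans hM) α₀ hα (ha.trans haFa0)) (he1 := fun x hM α₀ hα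 ha => he1 x (hM0F.trans hM) α₀ hα (ha.trans haFa0)) (hI := fun x hM α₀ hα ha U hU hU' => (hFI x hM α₀ hα ha U hU hU').2) (hG0CT := fun x hM α₀ hα ha => hG0CT x (hM0F.trans hM) α₀ hα (ha.trans haFa0)) (hF := fun x hM α₀ hα ha => hF x (hM0F.trans hM) α₀ hα (ha.trans haFa0)) (h45X := fun x hM α₀ hα ha => h45X x (hM0F.trans hM) α₀ hα (ha.trans haFa0)) (h44m := fun x hM α₀ hα ha => h44m x (hM0F.trans hM) α₀ hα (ha.trans haFa0)) (h45Y := fun x hM α₀ hα ha => h45Y x (hM0F.trans hM) α₀ hα (ha.trans haFa0))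
  exact ⟨MW, aD, θ₂, BdT, Bd2T, BdX, BhD13, BZv, BXv, BLv, KX, Bz, Bxz, θS, θD, A₀S, AW, AQ, AD, AQ1, CR, θH, AI, AV, r12, MF, aF, MR, aR, Br, hMW, haD0, haDa, hθ₂0, hBdT, hBd2T, hBdX, hBhD13, hBZv, hBXv, hBLv, hKX, hBz, hBxz, hθS, hθD, hθH, hA₀S, hAW, hAQ, hAD, hAQ1, hCR, hAI, hAV,
    hLEG, hXd, hDg, hYd, hDV, hPX, hGT, hD2sup, hST, hr12, haF0, haFa, hMWF, fun x hM => hstepL2 x (hMFL.trans hM), hFI, hMR, haR0, haRF, hBr, hRG⟩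

end Summit.QuantumFields.YangMills.BalabanUVNodes.N06Level13D2Rgdd13LayerAtPinsPUW

end
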